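import Summits.PneNP.PneNP.Theses.SymmetryBudget
import Literature.Computability.Complexity.SymmetricCircuit
import Literature.Computability.Complexity.KarpProblems
import Literature.Computability.Complexity.ClayProblem
import Literature.Computability.Complexity.ClayProblemProofs
import Literature.Computability.Complexity.HamCircuitNP
import Literature.Combinatorics.SimpleGraph.HamiltonianCycleListings
import Literature.Computability.Complexity.FPStringBricks
import Literature.Computability.Complexity.CircuitClassesUniformProofs
import Literature.Computability.Complexity.CircuitClassesProofs
import Literature.Computability.Complexity.DeMorganSimulation
import Literature.Computability.Complexity.CircuitComposition
import Literature.Computability.Complexity.NegationElimination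
import Literature.Computability.Complexity.CircuitRestriction
import Literature.Computability.Complexity.ThresholdGadgets
import Summits.PneNP.PneNP.Theorems.SymmetryBudgetWindowBarrierStubHeaderHardwiring
import Summits.PneNP.PneNP.Theorems.WindowBarrier.Negative.BudgetZero
import Summits.PneNP.PneNP.Theorems.WindowBarrier.Negative.InvarianceAndBridge

/-!
# Disproof of `WindowBarrier` (crux `stmt-PneNP-2145`, route `PneNP/SymmetryBudget`) — findings

Standing adversary file (cdisprove seat `refuter-cdisprove-stmt-PneNP-2145-0`). Prose lives in
docstrings; everything else is checked Lean (`lean check` rc 0, NO `sorry`; axioms ⊆ {propext,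
Classical.choice, Quot.sound}).

## The crux, unfolded (`windowBarrier_iff`, `Iff.rfl`)

`WindowBarrier ↔ WindowBarrierAt (Nat.log 2)` where
`WindowBarrierAt g := ∃ L ∈ Classes.P, InvariantSlices g L ∧ HardSlices g L`:
some polynomial-time language `L ⊆ {0,1}*` whose graph slices
`slice L m : (Fin m × Fin m → Bool) → Bool`, `x ↦ [encode ⟨m, Gr m x⟩ ∈ L]`, are invariant under
the symmetry budget `Bud(m, g m) = pointStabiliserBudget m (g m)` (last `g m` vertices free) and,
for every polynomial `p`, infinitely often have NO `Bud`-symmetric `tcBasis` circuit of size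
`≤ p m` (`HasSymCircuit`, verbatim the route's inline `HasSym`; `Circuit.isSymmetricUnder_iff`).
`PolylogBarrier ↔ WindowBarrierAt (fun m => Nat.log 2 m ^ 2)` (`polylogBarrier_iff`).

## Findings (cycle 1)

* F1 (elaboration / typing). The statement elaborates (route file rc 0); read back symbol by
  symbol: no junk operators (`Nat.log 2 m`, `Polynomial.eval`, `decide` via
  `Classical.propDecidable`, `SimpleGraph.fromRel` symmetrises and drops loops exactly as
  `encodingGraphFin` decodes); quantifier order matches the informal text (`∃ L ∀ p ∃ᶠ m`);
  `Classes.P` is the genuine TM2 class (nonempty, large closure library), not a placeholder.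
  The inline `Sym` is `Circuit.IsSymmetricUnder` (`Iff.rfl`) and over `tcBasis` symmetry implies
  invariance (`Circuit.IsSymmetricUnder.invariant_of_computes`), so `¬ HasSym` is NOT vacuous
  and NOT trivially true for invariant functions.
* F2 (why no cheap kill exists — a refutation is a generic bridge). `¬ WindowBarrier` says: EVERY
  `L ∈ P` with `Bud(m,⌊log₂ m⌋)`-invariant slices has polynomial-size `Bud`-symmetric threshold
  circuits for all large `m` ("no hidden order at scale `log m`"). Checked consequence
  (`pneNP_of_not_windowBarrier_of_windowHam`): `¬ WindowBarrier → WindowHam → PneNP`, through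
  `windowBarrier_of_windowHam_of_mem_P : HAMCIRCUIT ∈ Classes.P → WindowHam → WindowBarrier`
  (HAMCIRCUIT itself is then the witness: its slices are invariant under ALL vertex permutations).
  So refuting this crux is at least as strong as turning the route's lower-bound crux `WindowHam`
  DIRECTLY into `P ≠ NP`, i.e. it is exactly the generic all-of-`P` equivariant compilation at
  scale `log m` that the route deliberately does not claim (only the HAM-specific `HamCompiles`).
  No finite computation, degenerate parameter or junk model can produce such a compilation.
* F3 (load-bearing clause 1 = invariance: without it the crux is TRIVIALLY TRUE). A slice that is
  not `Bud`-invariant at `m` has no `Bud`-symmetric `tcBasis` circuit of ANY size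
  (`not_hasSymCircuit_of_not_invariant`, `hardSlices_of_frequently_not_invariant`); concretely the
  `P`-language `probeLang` reading the single adjacency bit `(0, m-1)` satisfies the hardness clause
  at every `m ≥ 4` with no lower-bound argument (`hardSlices_probeLang`,
  `windowBarrier_without_invariance`). Hence any proof must manufacture hardness for an INVARIANT
  slice; any disproof may assume invariance.
* F3' (load-bearing clause 2 = symmetry: without it the crux is FALSE). At budget `0`
  (`Bud = {1}`, every circuit qualifies) the statement is refuted outright from the tree's
  `P ⊆ P/poly` (`not_windowBarrierAt_zero`, via `slice_circuit_of_mem_P`: every `L ∈ P` has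
  poly-size threshold circuits for its graph slices — `P_subset_PPoly_holds` + `CktSize` composition
  with the one-gate-per-bit code map + `CktSize.deMorgan_of_B2`). Given the support item `Symmetrise`
  (g!-blow-up, elementary) the same refutation covers every budget with `g! ≤ poly(m)`
  (`not_windowBarrierAt_of_factorial_le : Symmetrise → (∀ m, (g m)! ≤ r m) → ¬ WindowBarrierAt g`):
  the checked form of the route's "bridge edge".
* F4 (degenerate instances are absorbed). `∃ᶠ m in atTop` absorbs small `m` (`Nat.log 2 m = 0`
  for `m ≤ 1`, budget trivial); the `∀ m`-strengthening of the hardness clause is false for every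
  `L` already at `m = 0` (`hasSymCircuit_fin_zero`, `not_hardSlicesEverywhere`), so the planner's
  `∃ᶠ` is the right quantifier and no degenerate-`m` refutation exists.
* F5 (budget regimes; monotonicity). Hardness is monotone UP in the budget and invariance
  monotone DOWN (`hardSlices_mono`, `invariantSlices_anti`); a single `L ∈ P` invariant at budget
  `⌊log₂ m⌋²` and hard at budget `⌊log₂ m⌋` would prove `WindowBarrier ∧ PolylogBarrier`
  (`windowBarrierAt_of_common_witness`). Neither of `WindowBarrier`, `PolylogBarrier` formally
  implies the other. Regimes: `g m = 0` — FALSE (`not_windowBarrierAt_zero`, F3'); `g! ≤ poly` —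
  false given additionally the support item `Symmetrise`; `g ≥ ⌊log₂ m⌋²` — `PolylogBarrier`
  (theorem-level, supports + counting width); the crux sits strictly between, where no lower-bound
  method for orbits in `(2^g, g!)` is in print (Dawar–Wilsenach, ToC 21 (2025) §6) and no
  equivariant compilation either.
* F6 (literature / negatives). `ledger negatives --problem PneNP` (5 refuted items, 2026-08-16:
  magnification frontier, OR-incompressibility, Lyapunov/PHP, Bavard gap, two-tones) and the
  catalogue `Literature/Barriers/PneNP/*` (no entry on symmetric circuits; Locality, NaturalProofs,
  TSPExtensionComplexity are the route's own citations) contain no refutation pattern applicable to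
  an ∃-over-`P` symmetric lower bound; the Locality barrier (CHOPRS, arXiv:1911.08297) PREDICTS the
  crux true (it is the symmetric analogue of "localisable lower bounds localise"), it does not
  refute it. (`lit search` was unavailable throughout cycle 1 — searchd rc 75; context for F8 read
  from Abu Zaid–Grädel–Grohe–Pakusa 2014 via galaxy.)

## Landed (Theorems lane, importable)

* `Summits/PneNP/PneNP/Theorems/WindowBarrier/Negative/InvarianceAndBridge.lean` (p75221, accepted;
  namespace `Summit.PneNP.WindowBarrier.Negative`): `not_hasSymCircuit_of_not_invariant`,
  `hardness_without_invariance`, `probe_slice_not_invariant`, `encode_mem_HAMCIRCUIT_iff`,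
  `isHamiltonian_relabel_iff`, `windowHam_imp_windowBarrier_of_ham_mem_P`,
  `ham_not_mem_P_of_not_windowBarrier`.
* `Summits/PneNP/PneNP/Theorems/WindowBarrier/Negative/BudgetZero.lean` (p75562, accepted;
  same namespace): `slice_circuit_of_mem_P`, `windowBarrier_false_at_budget_zero`,
  `slice_B2circuit_of_mem_P`, `windowBarrierAt_false_of_factorial_le`.
  (Reviewer pointers: `eval_mono_nat` duplicates `Literature.Computability.Complexity.natPoly_eval_mono`;
  a sibling seat landed `Theorems/HamCompiles/Negative/NonuniformCollapse.lean`.)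

* F7 (rescaling: the crux is an EXPONENTIAL symmetric lower bound in the free-part size). Write
  `n = ⌊log₂ m⌋` for the number of free vertices, so `poly(m) = 2^{O(n)}`. On inputs whose free
  vertices all have the same neighbourhood in the ordered part (the only inputs where the ordered
  part does not canonically order the free part outright), a slice is an isomorphism-invariant
  property of an `n`-vertex graph `H` together with `poly(2^n)` ordered side bits. Every invariant
  `P`-property of `H` has Sym_n-symmetric threshold circuits of size `n! · poly(n) = 2^{O(n log n)}`
  (`Symmetrise`), and the support-theorem lower bounds (Anderson–Dawar 2017 Thm 3/4; Dawar–Wilsenach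
  ToC 2025 Thm 6.2) stop at size `2^{n^{1-ε}}`. So `WindowBarrier` ⟺ (essentially) "some invariant
  `P`-property of `n`-vertex graphs, given exponentially many ordered advice bits, has symmetric
  threshold complexity `2^{ω(n)}` infinitely often", and `¬ WindowBarrier` ⟺ "symmetric complexity
  of invariant `P` is `2^{O(n)}`" — a `2^{O(n)}` symmetric CANONISATION of `n`-vertex (vertex-coloured)
  graphs would refute the crux, and is essentially required (take `L(s, H) = circuit_s(canon H)`,
  which is in `P` by Babai–Luks canonical labelling in time `2^{O(√(n log n))} = m^{o(1)}`).
* F8 (why orbit counting does not settle it either way). Affordable gate orbits at this scale are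
  exactly the subgroups of `Sym_n` of index `≤ 2^{O(n)}`: set stabilisers (all `2^n` subsets),
  ordered tuples of length `O(n / log n)`, bounded partitions — but not orderings (`n!`) nor sets of
  pairs (`2^{n(n-1)/2}`). Subset-indexed brute force kills every witness whose certificate is a
  subset or bounded-domain assignment on free VERTICES (CFI, vertex-variable `𝔽₂`-systems, bounded
  colour-class isomorphism inside the free part: `4^{n/4} < 2^n`), as the route says. Conversely,
  Babai's quasipolynomial canonical labelling branches only over tuples of length `polylog(n)`,
  orbit `n^{polylog n} ≪ 2^n`, so orbit size alone does NOT forbid a symmetric canoniser at this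
  scale; what is missing for a refutation is a CHOICELESS rendering of its group-theoretic
  subroutines (linear algebra over pair-indexed unknowns) — the same obstruction behind "does CPT
  capture P on bounded colour classes / define solvability of linear systems" (Abu Zaid–Grädel–
  Grohe–Pakusa, MFCS 2014, §1 and §5: open beyond abelian colours). Hence the natural hard
  candidates FOR the crux are `𝔽₂`-systems with unknowns on PAIRS of free vertices whose equations
  are read off `H` (e.g. "the all-ones 2-cochain on the triangles of `H` is a coboundary"), and a
  disproof would have to do symmetric Gaussian elimination on `Θ(n²)` unknowns with `2^{O(n)}` gates.

## Findings (cycle 2, seat `refuter-cdisprove-stmt-PneNP-2145-g2-0`, 2026-08-16)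

Context read at the boundary: line `canonical-form-completeness` PICKED (S3 landed, S2 bricks landed,
S1a = named fact `babaiLuks1983_canonicalForm`), the lead's reduction S4 ⟸ (★) CoreFooling, the
obstruction-side notes BarrierNotes-r1-k1/k2 (BN1–BN9: TAME := SIC ⇒ WindowCanonisation ⇒ ¬WB;
lifts unravel; V×V linear algebra is window-cheap; universal funnel NDS). This cycle's additions are
the sections from `ProbeCount` on at the end of the file (checked, no `sorry`).

* F9 (TARGETS: what a witness pair of S4 = `stub_symmetricIndistinguishability` must look like —
  kernel-checked). New symmetric gadget `probeCircuit P t`: `n` `∧`-gates indexed by an arbitrary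
  index set `Fin n` on which `Γ` acts (vertices: `θ = ρ`; ordered PAIRS of vertices: `θ = ρ × ρ`
  transported along `finProdFinEquiv`), gate `c` reading `r` probe wires `P c k`, followed by ONE
  majority gate with constant padding, `MAJ_{2n+2t}(probes, 1^n, 0^{2t}) = [t ≤ #firing probes]`.
  `hasSymCircuit_probeCount`: over `tcBasis`, size `n + 3`, `Γ`-symmetric and computing
  `x ↦ [t ≤ probeCount P x]` as soon as `ProbeEquivariant Γ P` (`ρ • P c = P (θ c)`). For a pair
  `(x, y)` fooling all `Γ`-symmetric threshold circuits of size `≤ s` (`Fools Γ s x y` — the second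
  clause of S4 at one `m`): T0 `Fools.apply_eq_of_fixed` (agreement on `Γ`-fixed entries, i.e. on
  the ordered × ordered block); T1 `Fools.probeCount_eq` (`s ≥ n + 3`: equal probe counts for every
  equivariant family); T2 `Fools.rowAttachmentCount_eq` / `colAttachmentCount_eq` / `diagCount_eq`
  (`s ≥ m + 3`: for every tuple `I` of ordered vertices the numbers `#{a | ∀ i ∈ I, x (a, i) = 1}`
  agree; by Möbius inversion over `I` the MULTISETS of attachment vectors of the free vertices to the
  ordered part coincide); T3 `Fools.pairProbeCount_eq` / `labelledEdgeCount_eq` (`s ≥ m² + 3`: equal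
  numbers of ordered pairs `(a, b)` with `x (a, b) = 1` and prescribed attachment patterns of `a` and
  of `b`). Corollary (paper; Möbius inversion twice): if the free vertices of `x` have pairwise
  distinct attachment vectors ("twin-free relative to the ordered part") then every `y` with
  `Fools (Bud m g) (m² + 3) x y` is a `Bud`-relabelling of `x` — such pairs are separated at size
  `m² + 3`. Hence S4 witnesses carry all their fooling on TWIN CLASSES of the ordered-part
  equivalence (classes the ordered part cannot order); the lead's core form (★) (every free vertex
  with the same attachment) is the extreme case. Known informally (route header, BN3/BN9); the point
  is the reusable checked gadget: any equivariant probe family over any affordable index orbit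
  (vertices, pairs; also the `2^g ≤ m` subsets of the free block, `Bud`-stable as a set — not yet
  enumerated here) now yields a `HasSymCircuit` witness in three lines.
* F10 (literature; `searchd` rc 75 again, galaxy up). (i) Abu Zaid–Grädel–Grohe–Pakusa, MFCS 2014
  (LNCS 8634, 50–62), pp. 1–3 and 15 read: CPT canonises `q`-bounded structures with ABELIAN colours;
  `q`-bounded in general, bounded degree, and solvability of linear systems over finite rings in CPT
  are listed OPEN (p. 15). So no choiceless canonisation beyond these is in print — neither a
  `2^{O(g)}` symmetric canoniser of `g`-vertex graphs (TAME, which would refute the crux via BN2) nor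
  a lower bound against one. (ii) Corneil–Goldberg 1984 (J. Algorithms 5, 345–362), the combinatorial
  `c^n` canoniser cited by Babai–Luks §1 and by `GraphCanonization.lean`: paywalled, acquisition
  acq-05398 filed. Decision value: IF its recursion were a dynamic programme over vertex SUBSETS with
  isomorphism-invariant cells it would literally be a symmetric `2^{O(g)}` canoniser; the interface
  problem of F8 (the canonical form of `G[S − v]` does not determine that of `G[S]`) makes this
  unlikely, to be checked on arrival. (iii) CPT precedents of BN3's materialisation tax (recollection,
  not re-read this cycle): the PADDED CFI query is CPT-definable (Blass–Gurevich–Shelah 2002),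
  unpadded over ordered bases (Dawar–Richerby–Rossman 2008), over bases with logarithmic colour
  classes (Pakusa–Schalthöfer–Selman 2016); CPT-canonisation of arbitrary graphs with `2^{O(n)}`
  padding is, as far as we can find, open both ways — the crux in logical clothing ("does symmetric
  poly-size computation capture `P` on structures with one unordered part of logarithmic size?").
* F11 (state of the disproof, for ideators and the lead). No cheap attack remains: degenerate and
  limiting regimes (F3–F5), junk models (F1), budget edges (F3', bridge edge), known witness families
  (BN2–BN9) are all settled, and the crux is equivalent in spirit to ¬TAME with TAME ⟸ SIC (subset
  discretisation, BN2) — the obstruction notes point to the crux being FALSE but unprovable with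
  present tools, while no witness candidate survives for the provers either. Checked pieces of the
  would-be refutation chain: `P ⊆ P/poly` for slices (`slice_circuit_of_mem_P`, landed), header
  hard-wiring (S3, landed by the lead), symmetric probe/count gadgets (this cycle). Next gadget for
  BN2's T1 `CanonisationKillsBarrier` (provable now, M): the multi-block composition lemma "a circuit
  reading only the outputs of `Γ`-symmetric blocks whose output gates are `Γ`-fixed is `Γ`-symmetric"
  (the arity-0-prefix case is `HeaderHardwiring.exists_isInducedAut_hardwire`). Missing for an actual
  `¬WindowBarrier`: SIC (open) + symmetric WL (L) + a canoniser in `P` (S1, XL).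

* F12 (T1 = BN2's `CanonisationKillsBarrier`, CHECKED; section `Cycle2b`). Symmetric composition
  in the straight-line model: `exists_isInducedAut_top` / `isSymmetricUnder_top` (hard-wiring an
  ARBITRARY circuit onto `Γ`-fixed wires of a `Γ`-symmetric multi-output prefix is `Γ`-symmetric,
  automorphism `τ ⊕ id`; with `exists_top`, `eval_top`, `size_top`, `isOver_top`) and
  `exists_snocPerm` (appending a `Γ`-symmetric single-output circuit to a symmetric prefix,
  automorphism `τ ⊕ σ`: prefixes are built from ordinary symmetric circuits). Consequence
  `windowBarrierAt_false_of_symCanonisation` / `not_windowBarrier_of_symCanonisation`: if some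
  polynomial-size `Bud(m,⌊log₂ m⌋)`-symmetric multi-output threshold prefix computes, for every
  `m ≥ 1`, a map `CF` with `CF x ∈ Bud • x` (`SymCanonisation`, the TAME object; canonicity is not even
  needed), then `¬ WindowBarrier` — compose with the `P ⊆ P/poly` slice circuit and use the invariance
  clause; and then `WindowHam → PneNP` (`pneNP_of_symCanonisation_of_windowHam`). So the ENTIRE
  refutation of the crux is now reduced, kernel-checked, to constructing the symmetric canoniser;
  by BN2 that is SIC (subset discretisation) + a symmetric WL implementation. Landing files prepared
  (`Negative/ProbeCount.lean`, `ProbeCountTargets.lean`, `SymmetricComposition.lean`,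
  `SymCanonisation.lean`); the gate's propose endpoint was unreachable during this cycle (EAGAIN /
  timeouts 03:30Z–05:00Z), so they are queued in the seat folder for the next boundary.

* F13 (bridge edge UNCONDITIONAL). The support item `Symmetrise` (stmt-PneNP-2146) was proved
  during this cycle (`Summit.PneNP.PneNP.Theorems.symmetrise_proof`); hence
  `not_windowBarrierAt_of_factorial_le symmetrise_proof r hg`: the crux is false at every budget `g`
  with `(g m)! ≤ poly(m)` — no hypothesis left — in particular at every constant budget. (The one-line
  corollaries `not_windowBarrierAt_of_factorial_le'`, `not_windowBarrierAt_const` sit in the seat folder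
  (Disproof_v10_with_bridge.lean / NegSymCanonisation.lean) until the farm has built the new module
  `SymmetryBudgetSymmetrise`, which this file would have to import.) The crux's budget `⌊log₂ m⌋`
  (`g! = m^{Θ(log log m)}`) is exactly the first scale this refutation misses (F3').

* F14 (S4 IS FALSE ON TWIN-FREE WITNESSES — checked; sections `Over`, `NegLayer`, `Profiles`,
  `PairProfiles`, `TwinFree`). New pieces: `exists_relocPerm` (THE composition lemma: relocating a
  circuit with automorphism `σ` over `π'` behind a symmetric prefix along an INTERTWINING wiring gives
  `τ ⊕ σ`; `top` and `snoc` are its special cases); `hasSymCircuit_probeCount_over` (probe counts over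
  any symmetric prefix); the negation layer `negLayer m` (m² `¬`-gates, symmetric under every vertex
  permutation) with literal wires `lit q b` carrying `[x q = b]`; `hasSymCircuit_litCount` (counting
  indices whose LITERAL probes all hold is symmetric-cheap: exact patterns, zeros included, are
  visible); T2⁺ `freeProfileCount_eq_of_fools` (size `m² + m + 3`: equal numbers of FREE vertices with
  each exact profile = row/column pattern on a tuple of ordered vertices + diagonal bit; ordered indices
  get dead probes); T3⁺ `freePairProfileCount_eq_of_fools` (size `2m² + 3`: equal numbers of ordered
  pairs of free vertices with prescribed profiles and prescribed entries `x (a,b)`, `x (b,a)`); and the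
  combinatorial core `budRelabel_of_counts` ⟹ **`budIso_of_fools_of_twinFree`**: if the free vertices
  of `x` have pairwise distinct profiles (twin-free relative to the ordered part) and `(x, y)` fools all
  `Bud(m,g)`-symmetric threshold circuits of size `≤ s`, `s ≥ 2m² + 3`, then `x ∘ (ρ × ρ) = y` for some
  `ρ ∈ Bud(m,g)` (`budRelabel_of_fools_of_twinFree`), so the graphs ARE `Bud`-isomorphic and `(x, y)`
  is not an S4 witness. Consequently every witness pair of `stub_symmetricIndistinguishability` (at any
  `p` with `p m ≥ 2m² + 3`) has twins relative to the ordered part and carries all of its fooling on the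
  twin classes: the lead's core form (★) is the shape of EVERY witness, not only a sufficient one. This
  is the checked converse companion of `S4_core_reduction` and closes the "order the free vertices by
  their neighbourhoods" half of the route's compilation remark for the stub.

* F15 (COMPUTATION, kit job j013124 `sic-cfi-marking`, attached to the item as compute evidence;
  script `sic_cfi/main.py` in the seat folder). BN2's T3 ("SIC for bounded-degree CFI via percolation")
  quantified: CFI graphs over random 3-regular bases, `b = 20 … 640` base vertices (`n = 140 … 4480`),
  and over random 4-regular bases (`n ≤ 1920`), with and without the `a_e^0–a_e^1` link edges; 100
  random vertex markings `S` per size and density `p`; colour refinement (1-WL) on `(CFI(B), S)`.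
  Result: at `p = 1/2` CR is DISCRETE for 100/100 markings at every size and in every variant; at
  `p = 1/4` for 92–100/100; at `p = 0.1` for 5–71/100 (decreasing in `n`); at `p = 0.05` for 0–15/100.
  Every failure has largest stable class of size 2–4 (cubic) resp. ≤ 8 (quartic) = a surviving LOCAL
  gauge flip along an unmarked short cycle, i.e. a genuine automorphism of `(G, S)` (2-WL, tried on the
  small failures, never helps) — exactly the predicted mechanism, with frequency growing in `n` at fixed
  `p` as the expected number `Σ_C (1-p)^{Θ(|C|)}` of unmarked cycles does. So the canonical hard family
  falls to ONE marking of constant density plus 1-WL (not even 2-WL is needed): an S4 witness must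
  defeat constant-density markings, which no catalogued family does (BN2–BN9). Numbers, not a proof:
  SIC for all rigid graphs remains the open core.

## How a disproof would have to go (for the record; none is attempted as a proposal)

Fix `L ∈ P` with invariant slices. A `Bud`-symmetric poly-size circuit may contain a gate for
every SUBSET of the `g = ⌊log₂ m⌋` free vertices (orbit `≤ 2^g ≤ m`) and for every ordered tuple
of `O(g / log g)` free vertices, but not for every ordering (`g! = m^{Θ(log log m)}`) nor for
every set of PAIRS (`2^{g(g-1)/2}`). A disproof needs an equivariant canonisation of the free
part relative to the ordered part inside that orbit budget; subset-DP canonisation fails on the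
interface problem (the iso type of `G[S]` does not determine how a new vertex attaches), and
`(g/log g)`-dimensional Weisfeiler–Leman fails on CFI-type free parts. The natural hard
candidates FOR the crux (pair-variable `𝔽₂`-systems read off the free part; isomorphism of the
free part with the ordered pattern on the first `g` vertices) are exactly the functions such a
disproof would have to compile. Verdict of this cycle: resists; probably true; unprovable by
supports.
-/

set_option linter.dupNamespace false

namespace Summit.PneNP.PneNP.Cruxes.WindowBarrier.Disproof

open scoped Classical
open Filter Literature.Computability.Complexity Summit.PneNP.PneNP.Theses.SymmetryBudget
open _root_.Computability

/-! ### Named vocabulary (verbatim the route's inline `let`s) -/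

/-- The simple graph read off an `m × m` Boolean matrix (symmetrised, loops dropped): the route's
inline `Gr`. -/
def Gr (m : ℕ) (x : Fin m × Fin m → Bool) : SimpleGraph (Fin m) :=
  SimpleGraph.fromRel fun u v => x (u, v) = true

/-- The diagonal relabelling of a matrix by a vertex permutation, `x ∘ (ρ × ρ)`. -/
def relabel {m : ℕ} (ρ : Equiv.Perm (Fin m)) (x : Fin m × Fin m → Bool) : Fin m × Fin m → Bool :=
  fun q => x (ρ q.1, ρ q.2)

/-- The `m`-th graph slice of a language `L ⊆ {0,1}*`: `x ↦ [encode ⟨m, Gr m x⟩ ∈ L]`. -/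
noncomputable def slice (L : Language Bool) (m : ℕ) : (Fin m × Fin m → Bool) → Bool :=
  fun x => decide (encodingGraph.encode ⟨m, Gr m x⟩ ∈ L)

/-- Invariance clause at budget function `g`: every slice of `L` is `Bud(m, g m)`-invariant. -/
def InvariantSlices (g : ℕ → ℕ) (L : Language Bool) : Prop :=
  ∀ (m : ℕ), ∀ ρ ∈ pointStabiliserBudget m (g m), ∀ x : Fin m × Fin m → Bool,
    (encodingGraph.encode ⟨m, Gr m (fun q : Fin m × Fin m => x (ρ q.1, ρ q.2))⟩ ∈ L ↔
      encodingGraph.encode ⟨m, Gr m x⟩ ∈ L)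

/-- Hardness clause at budget function `g`: for every polynomial size bound, infinitely often the
slice has no `Bud(m, g m)`-symmetric threshold circuit within the bound. -/
def HardSlices (g : ℕ → ℕ) (L : Language Bool) : Prop :=
  ∀ p : Polynomial ℕ, ∃ᶠ m in atTop,
    ¬ HasSymCircuit tcBasis (pointStabiliserBudget m (g m)) (p.eval m) (slice L m)

/-- The crux parametrised by the budget function `g` (the crux is `g = Nat.log 2`, the support
item `PolylogBarrier` is `g = (Nat.log 2 ·)^2`). -/
def WindowBarrierAt (g : ℕ → ℕ) : Prop :=
  ∃ L ∈ Classes.P, InvariantSlices g L ∧ HardSlices g L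

/-- The crux IS `WindowBarrierAt (Nat.log 2)`, definitionally (the inline `Sym`/`HasSym`/`Bud`/`Gr`
are `Circuit.IsSymmetricUnder`/`HasSymCircuit tcBasis`/`pointStabiliserBudget`/`Gr`). -/
theorem windowBarrier_iff : WindowBarrier ↔ WindowBarrierAt (Nat.log 2) := Iff.rfl

/-- The support item `PolylogBarrier` is the same statement at budget `⌊log₂ m⌋²`. -/
theorem polylogBarrier_iff : PolylogBarrier ↔ WindowBarrierAt (fun m => Nat.log 2 m ^ 2) := Iff.rfl

/-- The lower-bound crux `WindowHam`, in the named vocabulary. -/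
theorem windowHam_iff :
    WindowHam ↔ ∀ p : Polynomial ℕ, ∃ᶠ m in atTop,
      ¬ HasSymCircuit tcBasis (pointStabiliserBudget m (Nat.log 2 m)) (p.eval m)
        (fun x : Fin m × Fin m → Bool => decide ((Gr m x).IsHamiltonian)) := Iff.rfl

/-! ### F3 — the invariance clause is the load-bearing one -/

/-- Symmetry implies invariance (Anderson–Dawar): a function that is NOT `Γ`-invariant has no
`Γ`-symmetric threshold circuit of any size. -/
theorem not_hasSymCircuit_of_not_invariant {m : ℕ} {Γ : Set (Equiv.Perm (Fin m))} {s : ℕ}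
    {f : (Fin m × Fin m → Bool) → Bool} (h : ∃ ρ ∈ Γ, ∃ x, f (relabel ρ x) ≠ f x) :
    ¬ HasSymCircuit tcBasis Γ s f := by
  rintro ⟨C, hB, -, hΓ, hf⟩
  obtain ⟨ρ, hρ, x, hx⟩ := h
  exact hx (hΓ.invariant_of_computes hB hf hρ x)

/-- Hence the hardness clause holds for free, at EVERY size bound, along any sequence of `m` where
the slice fails to be invariant: without the invariance clause the crux would be trivial. -/
theorem hardSlices_of_frequently_not_invariant {g : ℕ → ℕ} {L : Language Bool}
    (h : ∃ᶠ m in atTop, ∃ ρ ∈ pointStabiliserBudget m (g m), ∃ x,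
      slice L m (relabel ρ x) ≠ slice L m x) :
    HardSlices g L := fun _ => h.mono fun _ hm => not_hasSymCircuit_of_not_invariant hm

/-! ### F2 — a refutation is a generic bridge: `¬ WindowBarrier → WindowHam → PneNP` -/

/-- Membership of a graph code in `HAMCIRCUIT` is Hamiltonicity. -/
theorem encode_mem_HAMCIRCUIT_iff (m : ℕ) (G : SimpleGraph (Fin m)) :
    encodingGraph.encode ⟨m, G⟩ ∈ HAMCIRCUIT ↔ G.IsHamiltonian :=
  encodingGraph.mem_toLanguage_iff hamCircuitSet ⟨m, G⟩

/-- Relabelling the matrix by `ρ` yields an isomorphic graph (`ρ` itself is the isomorphism). -/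
def grRelabelIso {m : ℕ} (ρ : Equiv.Perm (Fin m)) (x : Fin m × Fin m → Bool) :
    Gr m (fun q : Fin m × Fin m => x (ρ q.1, ρ q.2)) ≃g Gr m x where
  toEquiv := ρ
  map_rel_iff' := by
    intro a b
    simp [Gr, SimpleGraph.fromRel_adj, ρ.injective.ne_iff]

/-- The slices of `HAMCIRCUIT` are invariant under EVERY vertex permutation, a fortiori under every
budget. -/
theorem invariantSlices_HAMCIRCUIT (g : ℕ → ℕ) : InvariantSlices g HAMCIRCUIT := by
  intro m ρ _ x
  rw [encode_mem_HAMCIRCUIT_iff, encode_mem_HAMCIRCUIT_iff]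
  exact Literature.Combinatorics.SimpleGraph.isHamiltonian_iff_of_iso (grRelabelIso ρ x)

/-- The slice of `HAMCIRCUIT` at `m` is the route's Hamiltonicity function. -/
theorem slice_HAMCIRCUIT (m : ℕ) :
    slice HAMCIRCUIT m = fun x : Fin m × Fin m → Bool => decide ((Gr m x).IsHamiltonian) := by
  funext x
  exact (decide_eq_decide).2 (encode_mem_HAMCIRCUIT_iff m (Gr m x))

/-- **If HAM were in `P`, `WindowHam` would prove the crux** (witness `L = HAMCIRCUIT`). -/
theorem windowBarrier_of_windowHam_of_mem_P (hP : HAMCIRCUIT ∈ Classes.P) (hW : WindowHam) :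
    WindowBarrier := by
  rw [windowBarrier_iff]
  refine ⟨HAMCIRCUIT, hP, invariantSlices_HAMCIRCUIT _, fun p => ?_⟩
  refine (windowHam_iff.1 hW p).mono fun m hm => ?_
  rwa [slice_HAMCIRCUIT]

/-- **A refutation of the crux upgrades `WindowHam` to `HAMCIRCUIT ∉ P` outright.** -/
theorem hamcircuit_not_mem_P_of_not_windowBarrier (h : ¬ WindowBarrier) (hW : WindowHam) :
    HAMCIRCUIT ∉ Classes.P := fun hP => h (windowBarrier_of_windowHam_of_mem_P hP hW)

/-- **… and hence to `P ≠ NP`** (Cook's classes; model bridges `P_bool_eq_holds`,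
`NP_bool_eq_holds` and `HAMCIRCUIT_mem_NP` are proved tree facts). So `¬ WindowBarrier` is a
generic bridge from the route's symmetric lower bound to the summit: refuting this crux is at
least as hard as that. -/
theorem pneNP_of_not_windowBarrier_of_windowHam (h : ¬ WindowBarrier) (hW : WindowHam) :
    PneNP := by
  show ∃ L : Language Bool, L ∈ PNPWave0.NP Bool ∧ L ∉ PNPWave0.P Bool
  refine ⟨HAMCIRCUIT, ?_, ?_⟩
  · rw [show PNPWave0.NP Bool = Nondeterministic.NP from NP_bool_eq_holds]
    exact HAMCIRCUIT_mem_NP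
  · rw [show PNPWave0.P Bool = Classes.P from P_bool_eq_holds]
    exact hamcircuit_not_mem_P_of_not_windowBarrier h hW

/-! ### F5 — monotonicity in the budget -/

/-- Hardness is monotone up in the budget (more symmetry demanded, fewer circuits qualify). -/
theorem hardSlices_mono {g g' : ℕ → ℕ} (hgg' : ∀ m, g m ≤ g' m) {L : Language Bool}
    (h : HardSlices g L) : HardSlices g' L := fun p =>
  (h p).mono fun m hm hS => hm <| by
    obtain ⟨C, hB, hs, hΓ, hf⟩ := hS
    exact ⟨C, hB, hs, hΓ.mono (pointStabiliserBudget_mono m (hgg' m)), hf⟩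

/-- Invariance is monotone down in the budget. -/
theorem invariantSlices_anti {g g' : ℕ → ℕ} (hgg' : ∀ m, g m ≤ g' m) {L : Language Bool}
    (h : InvariantSlices g' L) : InvariantSlices g L :=
  fun m ρ hρ x => h m ρ (pointStabiliserBudget_mono m (hgg' m) hρ) x

/-- A common witness — invariant at the larger budget, hard at the smaller — proves the statement at
every budget in between (e.g. `WindowBarrier ∧ PolylogBarrier`). -/
theorem windowBarrierAt_of_common_witness {g₁ g g₂ : ℕ → ℕ} (h₁ : ∀ m, g₁ m ≤ g m)
    (h₂ : ∀ m, g m ≤ g₂ m) {L : Language Bool} (hP : L ∈ Classes.P)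
    (hinv : InvariantSlices g₂ L) (hhard : HardSlices g₁ L) : WindowBarrierAt g :=
  ⟨L, hP, invariantSlices_anti h₂ hinv, hardSlices_mono h₁ hhard⟩

/-! ### F4 — the `∀ m` strengthening of the hardness clause is false (degenerate `m = 0`) -/

/-- `∧₀` is the constant `true`. -/
theorem and_zero_apply (v : Fin 0 → Bool) : (GateFn.and 0).2 v = true := by
  show decide (∀ i : Fin 0, v i = true) = true
  exact decide_eq_true fun i => i.elim0

/-- `∨₀` is the constant `false`. -/
theorem or_zero_apply (v : Fin 0 → Bool) : (GateFn.or 0).2 v = false := by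
  show decide (∃ i : Fin 0, v i = true) = false
  exact decide_eq_false fun h => h.elim fun i _ => i.elim0

/-- On the empty matrix every function has a symmetric threshold circuit with one gate (the
function is constant; `∧₀`/`∨₀` read no input). -/
theorem hasSymCircuit_fin_zero (Γ : Set (Equiv.Perm (Fin 0))) (f : (Fin 0 × Fin 0 → Bool) → Bool) :
    HasSymCircuit tcBasis Γ 1 f := by
  have e : Fin 0 ≃ Fin 0 × Fin 0 := Equiv.equivOfIsEmpty _ _
  have hconst : ∀ x : Fin 0 × Fin 0 → Bool, f x = f (fun q => q.1.elim0) := fun x =>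
    congrArg f (funext fun q => q.1.elim0)
  cases hb : f (fun q => q.1.elim0) with
  | true =>
    have hand : GateFn.and 0 ∈ tcBasis :=
      acBasis_subset_tcBasis (Or.inr (Set.mem_iUnion.2 ⟨0, Or.inl rfl⟩))
    convert hasSymCircuit_single (B := tcBasis) hand e Γ using 1
    funext x
    rw [and_zero_apply, hconst x, hb]
  | false =>
    have hor : GateFn.or 0 ∈ tcBasis :=
      acBasis_subset_tcBasis (Or.inr (Set.mem_iUnion.2 ⟨0, Or.inr rfl⟩))
    convert hasSymCircuit_single (B := tcBasis) hor e Γ using 1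
    funext x
    rw [or_zero_apply, hconst x, hb]

/-- The hardness clause with `∀ m` in place of `∃ᶠ m`. -/
def HardSlicesEverywhere (g : ℕ → ℕ) (L : Language Bool) : Prop :=
  ∀ p : Polynomial ℕ, ∀ m : ℕ,
    ¬ HasSymCircuit tcBasis (pointStabiliserBudget m (g m)) (p.eval m) (slice L m)

/-- … fails for every language and every budget (take `p = 1`, `m = 0`). -/
theorem not_hardSlicesEverywhere (g : ℕ → ℕ) (L : Language Bool) : ¬ HardSlicesEverywhere g L :=
  fun h => h 1 0 (by simpa using hasSymCircuit_fin_zero _ (slice L 0))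


/-! ### F3 (concrete) — the hardness clause alone is cheap: a `P` language with non-invariant slices

`probeLang ∈ P` reads ONE adjacency bit, that of the pair `(0, m-1)` (ordered vertex `0`, free vertex
`m-1`). Its slices are not `Bud(m,⌊log₂ m⌋)`-invariant for any `m ≥ 4` (swap the two free vertices
`m-1`, `m-2`), so by F3 they have no symmetric threshold circuits AT ALL there: `HardSlices` holds at
every budget `≥ ⌊log₂ m⌋` with no lower-bound argument whatsoever (`hardSlices_probeLang`). This is
the calibration "WindowBarrier minus invariance is a triviality" (`windowBarrier_without_invariance`);
the crux's content is entirely in demanding invariance AND hardness of the same `L`. -/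

section Concrete

/-- The probe `⟨a, b⟩ ↦ bitAt ⟨tail 1^{min(⟦a⟧,|b|)}, b⟩`: on a graph code `⟨encodeNat m, bits⟩`,
`m ≥ 1`, it returns `[bits[m-1]]`, the adjacency bit of the pair `(0, m-1)` (row-major). Tree bricks
only (`bitAtFn`, `binToUnaryFn`, `fanoutFn`, `fstP`, `sndP`, `List.tail`). -/
noncomputable def probeFn : List Bool → List Bool :=
  bitAtFn ∘ fanoutFn (List.tail ∘ binToUnaryFn ∘ fanoutFn sndP fstP) sndP

/-- `probeFn ∈ FP`. -/
theorem probeFn_mem_FP : probeFn ∈ FP :=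
  comp_mem_FP bitAtFn_mem_FP
    (fanoutFn_mem_FP (comp_mem_FP PRelSigma.tail_mem_FP
      (comp_mem_FP binToUnaryFn_mem_FP (fanoutFn_mem_FP sndP_mem_FP fstP_mem_FP))) sndP_mem_FP)

/-- The probe language: words whose probed bit is `1`. -/
noncomputable def probeLang : Language Bool := {w | probeFn w = [true]}

/-- `probeLang ∈ P` (equality test of two `FP` maps). -/
theorem probeLang_mem_P : probeLang ∈ Classes.P :=
  setOf_apply_eq_apply_mem_P probeFn_mem_FP (const_mem_FP [true])

/-- The probe on a pair. -/
theorem probeFn_boolPair (a b : List Bool) :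
    probeFn (boolPair a b) = bitAtFn (boolPair (ones (min (bitsToNat a) b.length - 1)) b) := by
  simp only [probeFn, Function.comp_apply, fanoutFn_apply, sndP_boolPair, fstP_boolPair,
    binToUnaryFn_boolPair]
  congr 2
  simp [ones, List.tail_replicate]

/-- Row-major position `m - 1` is the pair `(0, m-1)`. -/
theorem finProdFinEquiv_symm_pred {m : ℕ} (hm : 1 ≤ m) :
    finProdFinEquiv.symm (⟨m - 1, by nlinarith [Nat.sub_lt hm Nat.one_pos]⟩ : Fin (m * m)) =
      ((⟨0, hm⟩ : Fin m), (⟨m - 1, Nat.sub_lt hm Nat.one_pos⟩ : Fin m)) := by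
  rw [Equiv.symm_apply_eq]
  ext
  simp

/-- On a graph code with `m ≥ 1` vertices the probe returns the adjacency bit of `(0, m-1)`. -/
theorem probeFn_encode {m : ℕ} (hm : 1 ≤ m) (G : SimpleGraph (Fin m)) :
    probeFn (encodingGraph.encode ⟨m, G⟩) =
      [decide (G.Adj ⟨0, hm⟩ ⟨m - 1, Nat.sub_lt hm Nat.one_pos⟩)] := by
  rw [encodingGraph_encode, probeFn_boolPair]
  have hlen : ((encodingGraphFin m).encode G).length = m * m := by
    simp [encodingGraphFin, encodingBitVec]
  have hmin : min (bitsToNat (encodeNat m)) ((encodingGraphFin m).encode G).length - 1 = m - 1 := by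
    rw [bitsToNat_encodeNat, hlen, Nat.min_eq_left (Nat.le_mul_self m)]
  rw [hmin, bitAtFn_boolPair_of_lt _ _ (by simp [ones, hlen]; nlinarith [Nat.sub_lt hm Nat.one_pos])]
  simp only [ones, List.length_replicate, List.cons.injEq, and_true]
  show (List.ofFn fun k : Fin (m * m) =>
      decide (G.Adj (finProdFinEquiv.symm k).1 (finProdFinEquiv.symm k).2))[m - 1]'(by
        simp; nlinarith [Nat.sub_lt hm Nat.one_pos]) = _
  rw [List.getElem_ofFn, finProdFinEquiv_symm_pred hm]

/-- Hence the slice of `probeLang` at `m ≥ 1` is the single adjacency test `0 ~ m-1`. -/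
theorem slice_probeLang {m : ℕ} (hm : 1 ≤ m) (x : Fin m × Fin m → Bool) :
    slice probeLang m x = decide ((Gr m x).Adj ⟨0, hm⟩ ⟨m - 1, Nat.sub_lt hm Nat.one_pos⟩) := by
  refine (decide_eq_decide).2 ?_
  change probeFn (encodingGraph.encode ⟨m, Gr m x⟩) = [true] ↔ _
  rw [probeFn_encode hm]
  simp

/-- For `m ≥ 4` the slice of `probeLang` is NOT invariant under the budget `⌊log₂ m⌋ ≥ 2`: swapping
the free vertices `m-1` and `m-2` moves the probed pair. -/
theorem slice_probeLang_not_invariant {m : ℕ} (hm : 4 ≤ m) :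
    ∃ ρ ∈ pointStabiliserBudget m (Nat.log 2 m), ∃ x,
      slice probeLang m (relabel ρ x) ≠ slice probeLang m x := by
  have h1 : 1 ≤ m := by omega
  have hlog : 2 ≤ Nat.log 2 m := Nat.le_log_of_pow_le (by norm_num) (by omega)
  let a : Fin m := ⟨m - 1, by omega⟩
  let b : Fin m := ⟨m - 2, by omega⟩
  let z : Fin m := ⟨0, by omega⟩
  refine ⟨Equiv.swap a b, ?_, fun q => decide (q = (z, b)), ?_⟩
  · intro i hi
    refine Equiv.swap_apply_of_ne_of_ne ?_ ?_
    · rintro rfl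
      simp [a] at hi
      omega
    · rintro rfl
      simp [b] at hi
      omega
  · rw [slice_probeLang h1, slice_probeLang h1]
    have hza : (⟨0, h1⟩ : Fin m) = z := rfl
    have hma : (⟨m - 1, Nat.sub_lt h1 Nat.one_pos⟩ : Fin m) = a := rfl
    rw [hza, hma]
    have hswz : Equiv.swap a b z = z :=
      Equiv.swap_apply_of_ne_of_ne (by simp [a, z, Fin.ext_iff]; omega)
        (by simp [b, z, Fin.ext_iff]; omega)
    have hswa : Equiv.swap a b a = b := Equiv.swap_apply_left a b
    have hab : a ≠ b := by simp [a, b, Fin.ext_iff]; omega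
    have haz : a ≠ z := by simp [a, z, Fin.ext_iff]; omega
    have hadj' : (Gr m (relabel (Equiv.swap a b) fun q => decide (q = (z, b)))).Adj z a := by
      rw [Gr, SimpleGraph.fromRel_adj]
      refine ⟨haz.symm, Or.inl ?_⟩
      simp [relabel, hswz, hswa]
    have hadj : ¬ (Gr m fun q => decide (q = (z, b))).Adj z a := by
      rw [Gr, SimpleGraph.fromRel_adj]
      rintro ⟨-, h | h⟩
      · simp at h
        exact hab h
      · simp at h
        exact haz h.1
    rw [decide_eq_true hadj', decide_eq_false hadj]
    decide

/-- **The hardness clause of the crux, for free**: `probeLang` has no `Bud(m,⌊log₂ m⌋)`-symmetric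
threshold circuits of ANY size at any `m ≥ 4` — without any lower-bound technique. -/
theorem hardSlices_probeLang : HardSlices (Nat.log 2) probeLang :=
  hardSlices_of_frequently_not_invariant <| Filter.frequently_atTop.2 fun n =>
    ⟨max n 4, le_max_left _ _, slice_probeLang_not_invariant (le_max_right _ _)⟩

/-- **`WindowBarrier` with the invariance clause deleted is a (trivial) theorem**, at every budget
`g ≥ ⌊log₂ ·⌋` (so also at the `PolylogBarrier` budget): the clause that carries the crux is invariance. -/
theorem windowBarrier_without_invariance {g : ℕ → ℕ} (hg : ∀ m, Nat.log 2 m ≤ g m) :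
    ∃ L ∈ Classes.P, HardSlices g L :=
  ⟨probeLang, probeLang_mem_P, hardSlices_mono hg hardSlices_probeLang⟩

/-- … and the cheap witness is indeed not admissible for the crux: its slices are not invariant. -/
theorem not_invariantSlices_probeLang : ¬ InvariantSlices (Nat.log 2) probeLang := by
  intro h
  obtain ⟨ρ, hρ, x, hx⟩ := slice_probeLang_not_invariant (le_refl 4)
  exact hx ((decide_eq_decide).2 (h 4 ρ hρ x))

end Concrete


/-! ### Load-bearing hypothesis: SYMMETRY. At budget `0` the crux is FALSE (`P ⊆ P/poly`)

`WindowBarrierAt (fun _ => 0)` — the crux with the symmetry requirement deleted (`Bud(m,0) = {1}`,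
every circuit is `{1}`-symmetric) — is refuted outright: every `L ∈ P` has polynomial-size threshold
circuits for its graph slices, by the tree's `P_subset_PPoly_holds`, the `CktSize` composition
calculus (code map `x ↦ encode ⟨m, Gr m x⟩` costs one gate per code bit) and the `B₂ → {∧,∨,¬}`
simulation `CktSize.deMorgan_of_B2`. Together with F3: without invariance the crux is trivially TRUE,
without symmetry it is FALSE, and the support item `Symmetrise` (g!-blow-up) lifts this refutation to
every budget with `g! ≤ poly`, i.e. `g = O(log m / log log m)` — the bridge edge. The crux sits at the
first budget where neither argument applies. -/

section BudgetZero

/-- Length of a graph code. -/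
theorem length_encode_graph (m : ℕ) (G : SimpleGraph (Fin m)) :
    (encodingGraph.encode ⟨m, G⟩).length = 2 * (encodeNat m).length + 2 + m * m := by
  rw [encodingGraph_encode, length_boolPair]
  simp [encodingGraphFin, encodingBitVec]

/-- The (input-independent) length of the code of an `m`-vertex graph. -/
def codeLen (m : ℕ) : ℕ := 2 * (encodeNat m).length + 2 + m * m

/-- `|encodeNat m| ≤ m`. -/
theorem length_encodeNat_le (m : ℕ) : (encodeNat m).length ≤ m := by
  induction m with
  | zero => exact le_of_eq (by rfl)
  | succ m ih => exact (length_encodeNat_succ_le m).trans (by omega)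

/-- `codeLen m ≤ (m + 2)^2`. -/
theorem codeLen_le (m : ℕ) : codeLen m ≤ (m + 2) ^ 2 := by
  have := length_encodeNat_le m
  unfold codeLen
  nlinarith

/-- The code map `x ↦ encode ⟨m, Gr m x⟩` as a bit-vector-valued function. -/
noncomputable def codeFn (m : ℕ) (x : Fin m × Fin m → Bool) (k : Fin (codeLen m)) : Bool :=
  (encodingGraph.encode ⟨m, Gr m x⟩).getD k false

/-- The code map lists the code. -/
theorem ofFn_codeFn (m : ℕ) (x : Fin m × Fin m → Bool) :
    List.ofFn (codeFn m x) = encodingGraph.encode ⟨m, Gr m x⟩ := by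
  apply List.ext_getElem
  · rw [List.length_ofFn, length_encode_graph]; rfl
  · intro k h1 h2
    rw [List.getElem_ofFn]
    show (encodingGraph.encode ⟨m, Gr m x⟩).getD k false = _
    rw [List.getD_eq_getElem?_getD, List.getElem?_eq_getElem h2, Option.getD_some]

/-- Every code bit is either constant in `x` (header, diagonal) or the symmetrised entry
`x(i,j) ∨ x(j,i)` of one off-diagonal pair. -/
theorem codeFn_bit (m : ℕ) (k : Fin (codeLen m)) :
    (∃ b, ∀ x, codeFn m x k = b) ∨
      (∃ i j : Fin m, i ≠ j ∧ ∀ x, codeFn m x k = (x (i, j) || x (j, i))) := by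
  have hsplit : ∀ (G : SimpleGraph (Fin m)), encodingGraph.encode ⟨m, G⟩ =
      boolPair (encodeNat m) [] ++ (encodingGraphFin m).encode G := by
    intro G
    rw [encodingGraph_encode]
    simp [boolPair]
  by_cases hk : (k : ℕ) < (boolPair (encodeNat m) []).length
  · refine Or.inl ⟨(boolPair (encodeNat m) []).getD k false, fun x => ?_⟩
    show (encodingGraph.encode ⟨m, Gr m x⟩).getD k false = _
    rw [hsplit, List.getD_append _ _ _ _ hk]
  · rw [not_lt] at hk
    set k' : ℕ := (k : ℕ) - (boolPair (encodeNat m) []).length with hk'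
    have hbody : ∀ x, codeFn m x k = ((encodingGraphFin m).encode (Gr m x)).getD k' false := by
      intro x
      show (encodingGraph.encode ⟨m, Gr m x⟩).getD k false = _
      rw [hsplit, List.getD_append_right _ _ _ _ hk]
    by_cases hk2 : k' < m * m
    · -- an adjacency bit
      set q : Fin m × Fin m := finProdFinEquiv.symm ⟨k', hk2⟩ with hq
      have hbit : ∀ x, codeFn m x k = decide ((Gr m x).Adj q.1 q.2) := by
        intro x
        rw [hbody x]
        have hlen : ((encodingGraphFin m).encode (Gr m x)).length = m * m := by
          simp [encodingGraphFin, encodingBitVec]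
        rw [List.getD_eq_getElem?_getD, List.getElem?_eq_getElem (by rw [hlen]; exact hk2),
          Option.getD_some]
        show (List.ofFn fun kk : Fin (m * m) => decide ((Gr m x).Adj (finProdFinEquiv.symm kk).1
          (finProdFinEquiv.symm kk).2))[k']'(by simpa using hk2) = _
        rw [List.getElem_ofFn]
      by_cases hij : q.1 = q.2
      · refine Or.inl ⟨false, fun x => ?_⟩
        rw [hbit x, hij]
        exact decide_eq_false (SimpleGraph.irrefl (Gr m x))
      · refine Or.inr ⟨q.1, q.2, hij, fun x => ?_⟩
        rw [hbit x]
        have hadj : (Gr m x).Adj q.1 q.2 ↔ (x (q.1, q.2) = true ∨ x (q.2, q.1) = true) := by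
          rw [Gr, SimpleGraph.fromRel_adj]
          exact ⟨fun h => h.2, fun h => ⟨hij, h⟩⟩
        rw [(decide_eq_decide.2 hadj : decide ((Gr m x).Adj q.1 q.2) =
          decide (x (q.1, q.2) = true ∨ x (q.2, q.1) = true))]
        cases x (q.1, q.2) <;> cases x (q.2, q.1) <;> simp
    · refine Or.inl ⟨false, fun x => ?_⟩
      rw [hbody x]
      have hlen : ((encodingGraphFin m).encode (Gr m x)).length = m * m := by
        simp [encodingGraphFin, encodingBitVec]
      exact List.getD_eq_default _ _ (by rw [hlen]; exact Nat.not_lt.1 hk2)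

/-- The code map costs at most one `B₂` gate per code bit. -/
theorem cktSize_codeFn (m : ℕ) : CktSize B2 (codeFn m) (codeLen m) := by
  have h : ∀ k : Fin (codeLen m),
      CktSize B2 (fun (x : Fin m × Fin m → Bool) (_ : Unit) => codeFn m x k) 1 := by
    intro k
    rcases codeFn_bit m k with ⟨b, hb⟩ | ⟨i, j, -, hij⟩
    · exact (cktSize_const (Fin m × Fin m) b).congr fun x _ => (hb x).symm
    · exact (cktSize_or (i, j) (j, i)).congr fun x _ => (hij x).symm
  simpa using CktSize.pi_const h

/-- `{∧₂, ∨₂, ¬} ⊆ tcBasis`. -/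
theorem deMorganBasis_subset_tcBasis : deMorganBasis ⊆ tcBasis := by
  intro f hf
  simp only [deMorganBasis, Set.mem_insert_iff, Set.mem_singleton_iff] at hf
  refine acBasis_subset_tcBasis ?_
  rcases hf with rfl | rfl | rfl
  · exact Or.inr (Set.mem_iUnion.2 ⟨2, Or.inl rfl⟩)
  · exact Or.inr (Set.mem_iUnion.2 ⟨2, Or.inr rfl⟩)
  · exact Or.inl rfl

/-- Evaluation of an `ℕ`-polynomial is monotone. -/
theorem eval_mono_nat (p : Polynomial ℕ) {a b : ℕ} (h : a ≤ b) : p.eval a ≤ p.eval b := by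
  induction p using Polynomial.induction_on' with
  | add p q hp hq => simpa only [Polynomial.eval_add] using Nat.add_le_add hp hq
  | monomial n c =>
    simp only [Polynomial.eval_monomial]
    exact Nat.mul_le_mul_left c (Nat.pow_le_pow_left h n)

/-- `L.boolIndicator w = [w ∈ L]`. -/
theorem boolIndicator_eq_decide (L : Language Bool) (w : List Bool) :
    L.boolIndicator w = decide (w ∈ L) := by
  by_cases h : w ∈ L
  · rw [(Set.mem_iff_boolIndicator (s := L) w).1 h, decide_eq_true h]
  · rw [(Set.notMem_iff_boolIndicator (s := L) w).1 h, decide_eq_false h]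

/-- **`P ⊆ P/poly` for graph slices**: every `L ∈ P` has, for some polynomial `q` and every `m ≥ 1`,
a threshold circuit of size `≤ q m` computing its `m`-th graph slice (tree facts
`P_subset_PPoly_holds`, `CktSize.comp`, `CktSize.deMorgan_of_B2`). -/
theorem slice_circuit_of_mem_P {L : Language Bool} (hL : L ∈ Classes.P) :
    ∃ q : Polynomial ℕ, ∀ m, 1 ≤ m →
      ∃ C : Circuit (Fin m × Fin m), C.IsOver tcBasis ∧ C.size ≤ q.eval m ∧ C.Computes (slice L m) := by
  have hPP : L ∈ PPoly := P_subset_PPoly_holds hL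
  simp only [PPoly, Set.mem_iUnion] at hPP
  obtain ⟨p, Cfam, hC, hDec⟩ := hPP
  refine ⟨12 * ((Polynomial.X + 2) ^ 2 + p.comp ((Polynomial.X + 2) ^ 2)) + 3, fun m hm => ?_⟩
  have h1 : CktSize B2 (fun (u : Fin (codeLen m) → Bool) (_ : Unit) => (Cfam (codeLen m)).eval u)
      (Cfam (codeLen m)).size := Circuit.cktSize_eval _ (hC _).1
  have h3 := ((cktSize_codeFn m).comp h1).deMorgan_of_B2 ((⟨0, hm⟩ : Fin m), (⟨0, hm⟩ : Fin m))
  obtain ⟨C, hB, hs, hev⟩ := (h3.basis_mono deMorganBasis_subset_tcBasis).toCircuit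
  refine ⟨C, hB, hs.trans ?_, fun x => ?_⟩
  · have hsz : (Cfam (codeLen m)).size ≤ p.eval ((m + 2) ^ 2) :=
      (hC _).2.trans (eval_mono_nat p (codeLen_le m))
    have hcl := codeLen_le m
    simp only [Polynomial.eval_add, Polynomial.eval_mul, Polynomial.eval_pow, Polynomial.eval_X,
      Polynomial.eval_comp, Polynomial.eval_ofNat]
    nlinarith
  · rw [hev x, hDec.eval_eq, ofFn_codeFn, boolIndicator_eq_decide]
    rfl

/-- **The crux without its symmetry requirement is FALSE**: `¬ WindowBarrierAt (fun _ => 0)`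
(budget `0`: `Bud = {1}`, every circuit qualifies; refuted by `P ⊆ P/poly`). Any proof of the crux
must use the symmetry demand `g = ⌊log₂ m⌋` essentially (and, by `Symmetrise`, more than the
g!-counting that settles `g! ≤ poly`). -/
theorem not_windowBarrierAt_zero : ¬ WindowBarrierAt (fun _ => 0) := by
  rintro ⟨L, hL, -, hhard⟩
  obtain ⟨q, hq⟩ := slice_circuit_of_mem_P hL
  obtain ⟨m, hno, hm⟩ := ((hhard q).and_eventually (eventually_ge_atTop 1)).exists
  obtain ⟨C, hB, hs, hcomp⟩ := hq m hm
  refine hno ⟨C, hB, hs, ?_, hcomp⟩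
  rw [pointStabiliserBudget_zero]
  exact C.isSymmetricUnder_one

end BudgetZero


/-! ### The bridge edge: given `Symmetrise`, the crux is false at every budget with `g! ≤ poly` -/

section SmallBudget

/-- `B₂` version of `slice_circuit_of_mem_P` (no basis conversion): every `L ∈ P` has poly-size
`B₂`-circuits for its graph slices. -/
theorem slice_B2circuit_of_mem_P {L : Language Bool} (hL : L ∈ Classes.P) :
    ∃ q : Polynomial ℕ, ∀ m,
      ∃ C : Circuit (Fin m × Fin m), C.IsOver B2 ∧ C.size ≤ q.eval m ∧ C.Computes (slice L m) := by
  have hPP : L ∈ PPoly := P_subset_PPoly_holds hL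
  simp only [PPoly, Set.mem_iUnion] at hPP
  obtain ⟨p, Cfam, hC, hDec⟩ := hPP
  refine ⟨(Polynomial.X + 2) ^ 2 + p.comp ((Polynomial.X + 2) ^ 2), fun m => ?_⟩
  have h1 : CktSize B2 (fun (u : Fin (codeLen m) → Bool) (_ : Unit) => (Cfam (codeLen m)).eval u)
      (Cfam (codeLen m)).size := Circuit.cktSize_eval _ (hC _).1
  obtain ⟨C, hB, hs, hev⟩ := ((cktSize_codeFn m).comp h1).toCircuit
  refine ⟨C, hB, hs.trans ?_, fun x => ?_⟩
  · have hsz : (Cfam (codeLen m)).size ≤ p.eval ((m + 2) ^ 2) :=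
      (hC _).2.trans (eval_mono_nat p (codeLen_le m))
    have hcl := codeLen_le m
    simp only [Polynomial.eval_add, Polynomial.eval_pow, Polynomial.eval_X, Polynomial.eval_comp,
      Polynomial.eval_ofNat]
    omega
  · rw [hev x, hDec.eval_eq, ofFn_codeFn, boolIndicator_eq_decide]
    rfl

/-- **Bridge edge.** If the support item `Symmetrise` holds (g!-symmetrisation of a `B₂`-circuit,
elementary) then the crux is FALSE at every budget function `g` with `(g m)! ≤ r m` for a
polynomial `r` — i.e. for `g = O(log m / log log m)`: symmetrise the `P ⊆ P/poly` circuits of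
`slice_B2circuit_of_mem_P`. So the crux's budget `⌊log₂ m⌋` (where `g! = m^{Θ(log log m)}`) is the
first scale at which this refutation stops, exactly as the route's rationale claims; conversely a
proof of the crux at any budget with `g! ≤ poly` would refute `Symmetrise`. -/
theorem not_windowBarrierAt_of_factorial_le (hS : Symmetrise) {g : ℕ → ℕ} (r : Polynomial ℕ)
    (hg : ∀ m, (g m).factorial ≤ r.eval m) : ¬ WindowBarrierAt g := by
  rintro ⟨L, hL, hinv, hhard⟩
  obtain ⟨c, hc⟩ := hS
  obtain ⟨q, hq⟩ := slice_B2circuit_of_mem_P hL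
  obtain ⟨m, hno⟩ := (hhard (Polynomial.C c * (r * (q + 1)))).exists
  obtain ⟨C, hB, hs, hcomp⟩ := hq m
  have hinv' : ∀ ρ ∈ pointStabiliserBudget m (g m), ∀ x : Fin m × Fin m → Bool,
      slice L m (fun q : Fin m × Fin m => x (ρ q.1, ρ q.2)) = slice L m x :=
    fun ρ hρ x => (decide_eq_decide).2 (hinv m ρ hρ x)
  have hsym : HasSymCircuit tcBasis (pointStabiliserBudget m (g m))
      (c * ((g m).factorial * (C.size + 1))) (slice L m) := hc m (g m) (slice L m) hinv' C hB hcomp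
  refine hno (hsym.mono ?_)
  simp only [Polynomial.eval_mul, Polynomial.eval_C, Polynomial.eval_add, Polynomial.eval_one]
  exact Nat.mul_le_mul_left c (Nat.mul_le_mul (hg m) (by omega))

end SmallBudget

/-! ## Cycle 2 — symmetric gadgets (probe counts over any input type; composition `τ ⊕ σ`; negation
layer; literal/profile counts) and the TARGETS: T0–T3, T2⁺, T3⁺, and the twin-free separation
(S4 is false on twin-free witnesses). Identical to the landing files Negative/{ProbeCount,
ProbeCountTargets, SymmetricComposition, ProbeOverPrefix, ProfileCounts, TwinFreeSeparation}.lean. -/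

section Cycle2
open Literature.Computability.Complexity.GateList Summit.PneNP.PneNP.Theorems.HeaderHardwiring

section ProbeCount

variable {ι : Type*} {n r : ℕ}

/-- The `∧ᵣ` gate reading the `r` probe wires `P c 0, …, P c (r-1)` attached to the index `c` (a
vertex, `n = m`, or a pair of vertices, `n = m²`, …). -/
def probeGate (P : Fin n → Fin r → ι) (c : Fin n) : Gate ι :=
  ⟨r, (GateFn.and r).2, fun k => Sum.inl (P c k)⟩

/-- Arguments of the counting gate: the `n` probe gates (indices `2 … n+1`), then `n` copies of
the constant `true` (gate `0`) and `2t` copies of the constant `false` (gate `1`). -/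
def majArgs (ι : Type*) (n t : ℕ) : Fin (n + (n + 2 * t)) → ι ⊕ ℕ :=
  Fin.append (fun a : Fin n => Sum.inr ((a : ℕ) + 2))
    (Fin.append (fun _ : Fin n => Sum.inr 0) (fun _ : Fin (2 * t) => Sum.inr 1))

/-- The counting gate `MAJ_{2n+2t}(probes, 1^n, 0^{2t})`: true iff at least `t` probes fire. -/
def majGate (ι : Type*) (n t : ℕ) : Gate ι :=
  ⟨n + (n + 2 * t), (GateFn.maj (n + (n + 2 * t))).2, majArgs ι n t⟩

/-- The probe-count program `[∧₀, ∨₀] ++ [probe gates] ++ [counting gate]`. -/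
def probeGates (P : Fin n → Fin r → ι) (t : ℕ) : List (Gate ι) :=
  [constGate _ true, constGate _ false] ++ List.ofFn (probeGate P) ++ [majGate ι n t]

/-- The probe-count program has `n + 3` gates. -/
theorem length_probeGates (P : Fin n → Fin r → ι) (t : ℕ) :
    (probeGates P t).length = n + 3 := by
  simp only [probeGates, List.length_append, List.length_cons, List.length_nil, List.length_ofFn]
  omega

/-- Where the arguments of the counting gate point. -/
theorem majArgs_cases (ι : Type*) (n t : ℕ) (i : Fin (n + (n + 2 * t))) :
    (∃ a : Fin n, majArgs ι n t i = Sum.inr ((a : ℕ) + 2)) ∨ majArgs ι n t i = Sum.inr 0 ∨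
      majArgs ι n t i = Sum.inr 1 := by
  induction i using Fin.addCases with
  | left a => exact Or.inl ⟨a, by simp [majArgs]⟩
  | right i =>
    induction i using Fin.addCases with
    | left b => exact Or.inr (Or.inl (by simp [majArgs]))
    | right c => exact Or.inr (Or.inr (by simp [majArgs]))

/-- The probe-count program is well formed. -/
theorem wf_probeGates (P : Fin n → Fin r → ι) (t : ℕ) : WF (probeGates P t) := by
  refine WF.append (WF.append ?_ ?_) ?_
  · exact (WF.singleton (gateOK_constGate 0 true)).append_singleton (gateOK_constGate 1 false)
  · intro j g hj a k hk
    obtain ⟨a', ha'⟩ : ∃ a', probeGate P a' = g := List.mem_ofFn.1 (List.mem_iff_getElem?.2 ⟨j, hj⟩)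
    subst ha'
    simp [probeGate] at hk
  · intro j g hj a k hk
    obtain ⟨rfl, rfl⟩ : j = 0 ∧ majGate ι n t = g := by simpa [List.getElem?_singleton] using hj
    change majArgs ι n t a = Sum.inr k at hk
    simp only [List.length_append, List.length_cons, List.length_nil, List.length_ofFn]
    rcases majArgs_cases ι n t a with ⟨b, hb⟩ | hb | hb <;> rw [hb] at hk <;>
      simp only [Sum.inr.injEq] at hk <;> omega

/-- **The probe-count circuit** of the probe family `P` at threshold `t`. -/
def probeCircuit (P : Fin n → Fin r → ι) (t : ℕ) : Circuit ι :=
  toCircuit (probeGates P t) (Sum.inr (n + 2)) (wf_probeGates P t) (fun k hk => by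
    rw [length_probeGates]
    have := Sum.inr.inj hk
    omega)

/-- The probe-count circuit has `n + 3` gates. -/
theorem probeCircuit_length (P : Fin n → Fin r → ι) (t : ℕ) :
    (probeCircuit P t).gates.length = n + 3 :=
  length_probeGates P t

/-- The size of the probe-count circuit is `n + 3`. -/
theorem size_probeCircuit (P : Fin n → Fin r → ι) (t : ℕ) :
    (probeCircuit P t).size = n + 3 :=
  length_probeGates P t

/-- Gate `0` is the constant `true`. -/
theorem probeCircuit_getElem_zero (P : Fin n → Fin r → ι) (t : ℕ)
    (h : 0 < (probeCircuit P t).gates.length) : (probeCircuit P t).gates[0] = constGate _ true := by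
  rfl

/-- Gate `1` is the constant `false`. -/
theorem probeCircuit_getElem_one (P : Fin n → Fin r → ι) (t : ℕ)
    (h : 1 < (probeCircuit P t).gates.length) : (probeCircuit P t).gates[1] = constGate _ false := by
  rfl

/-- Gate `a + 2` is the probe gate of index `a`. -/
theorem probeCircuit_getElem_probe (P : Fin n → Fin r → ι) (t : ℕ) (a : ℕ) (ha : a < n)
    (h : a + 2 < (probeCircuit P t).gates.length) :
    (probeCircuit P t).gates[a + 2] = probeGate P ⟨a, ha⟩ := by
  show (probeGates P t)[a + 2] = _
  simp only [probeGates]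
  rw [List.getElem_append_left (by simp; omega), List.getElem_append_right (by simp)]
  simp

/-- Gate `n + 2` is the counting gate. -/
theorem probeCircuit_getElem_maj (P : Fin n → Fin r → ι) (t : ℕ)
    (h : n + 2 < (probeCircuit P t).gates.length) : (probeCircuit P t).gates[n + 2] = majGate ι n t := by
  show (probeGates P t)[n + 2] = _
  simp only [probeGates]
  rw [List.getElem_append_right (by simp)]
  simp

/-- The probe-count circuit is a threshold circuit (`∧₀, ∨₀, ∧ᵣ ∈ acBasis`, `MAJ ∈ tcBasis`). -/
theorem probeCircuit_isOver (P : Fin n → Fin r → ι) (t : ℕ) :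
    (probeCircuit P t).IsOver tcBasis := by
  intro g hg
  change g ∈ [constGate _ true, constGate _ false] ++ List.ofFn (probeGate P) ++ [majGate ι n t] at hg
  rcases List.mem_append.1 hg with hg | hg
  · rcases List.mem_append.1 hg with hg | hg
    · simp only [List.mem_cons, List.not_mem_nil, or_false] at hg
      rcases hg with rfl | rfl
      · exact acBasis_subset_tcBasis (const_mem_acBasis true)
      · exact acBasis_subset_tcBasis (const_mem_acBasis false)
    · obtain ⟨a, rfl⟩ := List.mem_ofFn.1 hg
      exact acBasis_subset_tcBasis (and_mem_acBasis r)
  · rw [List.mem_singleton] at hg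
    subst hg
    exact maj_mem_tcBasis _

/-- The number of indices all of whose probes fire. -/
def probeCount (P : Fin n → Fin r → ι) (x : ι → Bool) : ℕ :=
  GateFn.numOnes fun a : Fin n => decide (∀ k : Fin r, x (P a k) = true)

/-- Gate equations of the probe-count circuit. -/
theorem probeCircuit_getD (P : Fin n → Fin r → ι) (t : ℕ) (x : ι → Bool)
    (j : ℕ) (hj : j < (probeCircuit P t).gates.length) :
    (vals (probeCircuit P t).gates x).getD j false =
      gateValue x (vals (probeCircuit P t).gates x) ((probeCircuit P t).gates[j]) := by
  have h1 : vals (probeCircuit P t).gates x = transcript x [] (probeCircuit P t).gates :=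
    (circuit_wireVals (probeCircuit P t) x).symm.trans (wireVals_eq_transcript _ x)
  rw [h1]
  exact getD_transcript_eq_gateValue (probeCircuit P t) x j hj

/-- **Semantics**: the probe-count circuit decides `t ≤ #{a | all probes of a fire}`. -/
theorem probeCircuit_eval (P : Fin n → Fin r → ι) (t : ℕ) (x : ι → Bool) :
    (probeCircuit P t).eval x = decide (t ≤ probeCount P x) := by
  have hlen : (probeCircuit P t).gates.length = n + 3 := length_probeGates P t
  have h0 : (vals (probeCircuit P t).gates x).getD 0 false = true := by
    rw [probeCircuit_getD P t x 0 (by omega), probeCircuit_getElem_zero]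
    rfl
  have h1 : (vals (probeCircuit P t).gates x).getD 1 false = false := by
    rw [probeCircuit_getD P t x 1 (by omega), probeCircuit_getElem_one]
    rfl
  have hprobe : ∀ a : Fin n, (vals (probeCircuit P t).gates x).getD ((a : ℕ) + 2) false =
      decide (∀ k : Fin r, x (P a k) = true) := by
    intro a
    rw [probeCircuit_getD P t x _ (by omega), probeCircuit_getElem_probe P t a a.2 (by omega)]
    rfl
  have hmaj : (vals (probeCircuit P t).gates x).getD (n + 2) false =
      decide (n + (n + 2 * t) ≤ 2 * GateFn.numOnes fun i =>
        wireVal x (vals (probeCircuit P t).gates x) (majArgs ι n t i)) := by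
    rw [probeCircuit_getD P t x _ (by omega), probeCircuit_getElem_maj P t (by omega)]
    rfl
  have hb1 : GateFn.numOnes (fun a : Fin n =>
      wireVal x (vals (probeCircuit P t).gates x) (Sum.inr ((a : ℕ) + 2))) = probeCount P x := by
    unfold probeCount
    congr 1
    funext a
    exact hprobe a
  have hb2 : (List.ofFn fun _ : Fin n => (Sum.inr 0 : ι ⊕ ℕ)).countP
      (fun w => wireVal x (vals (probeCircuit P t).gates x) w) = n := by
    rw [List.countP_eq_length.2 (fun w hw => ?_), List.length_ofFn]
    obtain ⟨i, rfl⟩ := List.mem_ofFn.1 hw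
    exact h0
  have hb3 : (List.ofFn fun _ : Fin (2 * t) => (Sum.inr 1 : ι ⊕ ℕ)).countP
      (fun w => wireVal x (vals (probeCircuit P t).gates x) w) = 0 := by
    rw [List.countP_eq_zero]
    intro w hw
    obtain ⟨i, rfl⟩ := List.mem_ofFn.1 hw
    show ¬ ((vals (probeCircuit P t).gates x).getD 1 false = true)
    rw [h1]
    exact Bool.false_ne_true
  have hcount : GateFn.numOnes (fun i => wireVal x (vals (probeCircuit P t).gates x) (majArgs ι n t i)) =
      probeCount P x + n := by
    rw [Circuit.numOnes_eq_countP_ofFn (wireVal x (vals (probeCircuit P t).gates x)) (majArgs ι n t),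
      majArgs, List.ofFn_fin_append, List.ofFn_fin_append, List.countP_append, List.countP_append,
      ← Circuit.numOnes_eq_countP_ofFn (wireVal x (vals (probeCircuit P t).gates x))
        (fun a : Fin n => (Sum.inr ((a : ℕ) + 2) : ι ⊕ ℕ)),
      hb1, hb2, hb3, Nat.add_zero]
  rw [circuit_eval]
  show wireOf x (vals (probeCircuit P t).gates x) (Sum.inr (n + 2)) = _
  rw [wireOf_inr, hmaj, hcount]
  exact (decide_eq_decide).2 ⟨fun h => by omega, fun h => by omega⟩

/-- A permutation of `Fin n` extended to `Fin (n + 1)` by fixing the last index. -/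
theorem exists_fixLastPerm (ρ : Equiv.Perm (Fin n)) :
    ∃ ρ' : Equiv.Perm (Fin (n + 1)), ∀ k : ℕ,
      Circuit.relabelGate ρ' k = if k < n then Circuit.relabelGate ρ k else k := by
  have hlt : ∀ (θ : Equiv.Perm (Fin n)) {v : ℕ}, v < n + 1 →
      (if v < n then Circuit.relabelGate θ v else v) < n + 1 := by
    intro θ v hv
    split_ifs with h
    · exact (Circuit.relabelGate_lt θ h).trans (Nat.lt_succ_self n)
    · exact hv
  have hinv : ∀ (θ : Equiv.Perm (Fin n)) {v : ℕ}, v < n + 1 →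
      (if (if v < n then Circuit.relabelGate θ v else v) < n then
          Circuit.relabelGate θ.symm (if v < n then Circuit.relabelGate θ v else v)
        else (if v < n then Circuit.relabelGate θ v else v)) = v := by
    intro θ v hv
    by_cases h : v < n
    · simp only [if_pos h, if_pos (Circuit.relabelGate_lt θ h)]
      exact relabelGate_symm_relabelGate θ h
    · simp only [if_neg h]
  refine ⟨⟨fun i => ⟨if (i : ℕ) < n then Circuit.relabelGate ρ i else i, hlt ρ i.2⟩,
    fun i => ⟨if (i : ℕ) < n then Circuit.relabelGate ρ.symm i else i, hlt ρ.symm i.2⟩,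
    fun i => Fin.ext (hinv ρ i.2),
    fun i => Fin.ext (by simpa only [Equiv.symm_symm] using hinv ρ.symm i.2)⟩, fun k => ?_⟩
  by_cases hk : k < n + 1
  · rw [Circuit.relabelGate_of_lt _ hk]
    rfl
  · have h1 : ¬ k < n := by omega
    rw [Circuit.relabelGate_of_le _ (not_lt.1 hk), if_neg h1]

/-- The gate permutation of the probe-count circuit induced by a vertex permutation `ρ`:
it fixes the two constants and the counting gate and moves probe gate `a` to probe gate `ρ a`. -/
theorem exists_probePerm {N : ℕ} (hN : N = n + 3) (θ : Equiv.Perm (Fin n)) :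
    ∃ τ : Equiv.Perm (Fin N), (∀ k, k < 2 → Circuit.relabelGate τ k = k) ∧
      (∀ a : Fin n, Circuit.relabelGate τ ((a : ℕ) + 2) = (θ a : ℕ) + 2) ∧
      Circuit.relabelGate τ (n + 2) = n + 2 := by
  obtain ⟨ρ', hρ'⟩ := exists_fixLastPerm θ
  obtain ⟨τ, hτ⟩ := exists_liftPerm 2 (by omega : N = (n + 1) + 2) ρ'
  refine ⟨τ, fun k hk => by rw [hτ, if_pos hk], fun a => ?_, ?_⟩
  · rw [hτ, if_neg (by omega), Nat.add_sub_cancel, hρ', if_pos a.2, Circuit.relabelGate_of_lt θ a.2]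
  · rw [hτ, if_neg (by omega), Nat.add_sub_cancel, hρ', if_neg (lt_irrefl n)]

/-- **Symmetry**: if the probe family is equivariant under a map `π` of the input variables and a
permutation `θ` of the indices (`π` carries the probes of `c` to the probes of `θ c`, position by
position), then `π` extends to an automorphism of the probe-count circuit (`θ` on the probe
gates; the constants and the counting gate are fixed). -/
theorem probeCircuit_isInducedAut (P : Fin n → Fin r → ι) (t : ℕ)
    (π : ι → ι) (θ : Equiv.Perm (Fin n)) (hP : ∀ (a : Fin n) (k : Fin r), π (P a k) = P (θ a) k) :
    ∃ τ : Equiv.Perm (Fin (probeCircuit P t).gates.length), (probeCircuit P t).IsInducedAut π τ := by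
  have hlen : (probeCircuit P t).gates.length = n + 3 := length_probeGates P t
  obtain ⟨τ, hτ2, hτa, hτm⟩ := exists_probePerm hlen θ
  refine ⟨τ, ?_, ?_⟩
  · show Circuit.relabelWire _ τ (Sum.inr (n + 2)) = Sum.inr (n + 2)
    rw [Circuit.relabelWire_inr, hτm]
  · rintro ⟨j, hj⟩
    simp only [Fin.getElem_fin]
    have hj3 : j < n + 3 := hlen ▸ hj
    have hjv : ((τ ⟨j, hj⟩ : Fin _) : ℕ) = Circuit.relabelGate τ j :=
      (Circuit.relabelGate_of_lt τ hj).symm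
    rcases Nat.lt_or_ge j 2 with hj2 | hj2
    · -- a constant gate: fixed, no arguments
      have hv : ((τ ⟨j, hj⟩ : Fin _) : ℕ) = j := by rw [hjv, hτ2 j hj2]
      rw [getElem_congr_idx hv]
      refine ⟨rfl, ?_⟩
      interval_cases j
      · rw [probeCircuit_getElem_zero,
          List.ofFn_eq_nil_iff.2 (rfl : (constGate ι true).arity = 0), List.map_nil]
      · rw [probeCircuit_getElem_one,
          List.ofFn_eq_nil_iff.2 (rfl : (constGate ι false).arity = 0), List.map_nil]
    rcases Nat.lt_or_ge j (n + 2) with hjm | hjm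
    · -- probe gate `a + 2` goes to probe gate `θ a + 2`
      obtain ⟨a, rfl⟩ : ∃ a, j = a + 2 := ⟨j - 2, by omega⟩
      have ha : a < n := by omega
      have hv : ((τ ⟨a + 2, hj⟩ : Fin _) : ℕ) = (θ ⟨a, ha⟩ : ℕ) + 2 := by rw [hjv, hτa ⟨a, ha⟩]
      rw [getElem_congr_idx hv]
      rw [probeCircuit_getElem_probe P t _ (θ ⟨a, ha⟩).2, probeCircuit_getElem_probe P t a ha]
      refine ⟨rfl, ?_⟩
      rw [List.map_ofFn]
      refine List.Perm.of_eq (congrArg List.ofFn (funext fun k => ?_))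
      show (Sum.inl (P (θ ⟨a, ha⟩) k) : ι ⊕ ℕ) = Sum.inl (π (P ⟨a, ha⟩ k))
      rw [hP]
    · -- the counting gate: fixed; its probe arguments are permuted by `θ`
      have hjm' : j = n + 2 := by omega
      subst hjm'
      have hv : ((τ ⟨n + 2, hj⟩ : Fin _) : ℕ) = n + 2 := by rw [hjv, hτm]
      rw [getElem_congr_idx hv]
      rw [probeCircuit_getElem_maj]
      refine ⟨rfl, ?_⟩
      show (List.ofFn (majArgs ι n t)).Perm ((List.ofFn (majArgs ι n t)).map (Circuit.relabelWire π τ))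
      rw [majArgs, List.ofFn_fin_append, List.ofFn_fin_append, List.map_append, List.map_append,
        List.map_ofFn, List.map_ofFn, List.map_ofFn]
      refine List.Perm.append ?_ (List.Perm.of_eq ?_)
      · have hb1 : (Circuit.relabelWire π τ ∘ fun a : Fin n => (Sum.inr ((a : ℕ) + 2) : ι ⊕ ℕ)) =
            (fun a : Fin n => (Sum.inr ((a : ℕ) + 2) : ι ⊕ ℕ)) ∘ θ := by
          funext a
          simp only [Function.comp_apply, Circuit.relabelWire_inr, hτa a]
        rw [hb1]
        exact (Equiv.Perm.ofFn_comp_perm θ _).symm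
      · congr 1
        · refine congrArg List.ofFn (funext fun b => ?_)
          simp only [Function.comp_apply, Circuit.relabelWire_inr, hτ2 0 (by norm_num)]
        · refine congrArg List.ofFn (funext fun c => ?_)
          simp only [Function.comp_apply, Circuit.relabelWire_inr, hτ2 1 (by norm_num)]

/-- Hence the probe-count circuit is `Γ`-symmetric for every `Γ` under which the probe family is
equivariant (every `ρ ∈ Γ` permutes the indices by some `θ` compatibly with its diagonal action on
the probe wires). -/
theorem probeCircuit_isSymmetricUnder {m : ℕ} (P : Fin n → Fin r → Fin m × Fin m) (t : ℕ)
    (Γ : Set (Equiv.Perm (Fin m)))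
    (hP : ∀ ρ ∈ Γ, ∃ θ : Equiv.Perm (Fin n), ∀ (a : Fin n) (k : Fin r),
      (ρ (P a k).1, ρ (P a k).2) = P (θ a) k) :
    (probeCircuit P t).IsSymmetricUnder Γ := fun ρ hρ => by
  obtain ⟨θ, hθ⟩ := hP ρ hρ
  exact probeCircuit_isInducedAut P t (fun q : Fin m × Fin m => (ρ q.1, ρ q.2)) θ hθ

/-- **Probe counts are symmetric-cheap**: for an equivariant probe family, `x ↦ [t ≤ #{c | all
probes of c fire on x}]` has a `Γ`-symmetric threshold circuit with `n + 3` gates. -/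
theorem hasSymCircuit_probeCount {m : ℕ} (P : Fin n → Fin r → Fin m × Fin m) (t : ℕ)
    (Γ : Set (Equiv.Perm (Fin m)))
    (hP : ∀ ρ ∈ Γ, ∃ θ : Equiv.Perm (Fin n), ∀ (a : Fin n) (k : Fin r),
      (ρ (P a k).1, ρ (P a k).2) = P (θ a) k) :
    HasSymCircuit tcBasis Γ (n + 3) (fun x => decide (t ≤ probeCount P x)) :=
  ⟨probeCircuit P t, probeCircuit_isOver P t, (size_probeCircuit P t).le,
    probeCircuit_isSymmetricUnder P t Γ hP, probeCircuit_eval P t⟩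

end ProbeCount


open Summit.PneNP.PneNP.Theorems.HeaderHardwiring

section PairProbes

variable {m r : ℕ}

/-- Pair-indexed probe families: the index set `Fin (m * m)` read as ordered pairs of vertices
through `finProdFinEquiv`; `Q q` lists the probes of the pair `q = (a, b)`. -/
def pairProbe (Q : Fin m × Fin m → Fin r → Fin m × Fin m) : Fin (m * m) → Fin r → Fin m × Fin m :=
  fun c => Q (finProdFinEquiv.symm c)

/-- A pair-indexed family with `ρ • Q (a, b) = Q (ρ a, ρ b)` is equivariant, with `θ = ρ × ρ`
transported to `Fin (m * m)`: gates indexed by PAIRS of vertices have orbits `≤ m²`. -/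
theorem pairProbe_equivariant (Γ : Set (Equiv.Perm (Fin m)))
    (Q : Fin m × Fin m → Fin r → Fin m × Fin m)
    (hQ : ∀ ρ ∈ Γ, ∀ (q : Fin m × Fin m) (k : Fin r), (ρ (Q q k).1, ρ (Q q k).2) = Q (ρ q.1, ρ q.2) k) :
    ∀ ρ ∈ Γ, ∃ θ : Equiv.Perm (Fin (m * m)), ∀ (c : Fin (m * m)) (k : Fin r),
      (ρ (pairProbe Q c k).1, ρ (pairProbe Q c k).2) = pairProbe Q (θ c) k := by
  intro ρ hρ
  refine ⟨finProdFinEquiv.symm.trans ((Equiv.prodCongr ρ ρ).trans finProdFinEquiv), fun c k => ?_⟩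
  simp only [pairProbe, Equiv.trans_apply, Equiv.symm_apply_apply]
  generalize finProdFinEquiv.symm c = q
  obtain ⟨a, b⟩ := q
  exact hQ ρ hρ (a, b) k

/-- Pair probe counts, read as a number of ordered pairs of vertices. -/
theorem probeCount_pairProbe (Q : Fin m × Fin m → Fin r → Fin m × Fin m) (x : Fin m × Fin m → Bool) :
    probeCount (pairProbe Q) x =
      (Finset.univ.filter fun q : Fin m × Fin m => ∀ k, x (Q q k) = true).card := by
  unfold probeCount GateFn.numOnes pairProbe
  refine Finset.card_equiv finProdFinEquiv.symm (fun c => ?_)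
  simp

/-- The labelled-edge probe of a pair `(a, b)`: the entry `(a, b)` itself, then the row
attachments `(a, I k)` of `a` and `(b, J k)` of `b` to ordered vertices. -/
def edgeProbe {r₁ r₂ : ℕ} (I : Fin r₁ → Fin m) (J : Fin r₂ → Fin m) (q : Fin m × Fin m) :
    Fin ((r₁ + r₂) + 1) → Fin m × Fin m :=
  Matrix.vecCons q (Fin.append (fun k => (q.1, I k)) (fun k => (q.2, J k)))

/-- The labelled-edge probe is `Bud(m, g)`-equivariant when `I`, `J` list ordered vertices
(`i + g < m`). -/
theorem edgeProbe_equivariant (g : ℕ) {r₁ r₂ : ℕ} (I : Fin r₁ → Fin m) (J : Fin r₂ → Fin m)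
    (hI : ∀ k, (I k : ℕ) + g < m) (hJ : ∀ k, (J k : ℕ) + g < m) :
    ∀ ρ ∈ pointStabiliserBudget m g, ∀ (q : Fin m × Fin m) (k : Fin ((r₁ + r₂) + 1)),
      (ρ (edgeProbe I J q k).1, ρ (edgeProbe I J q k).2) = edgeProbe I J (ρ q.1, ρ q.2) k := by
  intro ρ hρ q k
  refine Fin.cases ?_ (fun k => ?_) k
  · simp [edgeProbe]
  · simp only [edgeProbe, Matrix.cons_val_succ]
    induction k using Fin.addCases with
    | left k => simp [hρ (I k) (hI k)]
    | right k => simp [hρ (J k) (hJ k)]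

/-- Row probes into `Bud(m, g)`-fixed columns are equivariant (`θ = ρ`): `ρ (a, i) = (ρ a, i)`. -/
theorem rowProbe_equivariant (g : ℕ) (I : Fin r → Fin m) (hI : ∀ k, (I k : ℕ) + g < m) :
    ∀ ρ ∈ pointStabiliserBudget m g, ∃ θ : Equiv.Perm (Fin m), ∀ (a : Fin m) (k : Fin r),
      (ρ (a, I k).1, ρ (a, I k).2) = (θ a, I k) :=
  fun ρ hρ => ⟨ρ, fun _ k => Prod.ext rfl (hρ (I k) (hI k))⟩

/-- Column probes from `Bud(m, g)`-fixed rows are equivariant (`θ = ρ`): `ρ (i, a) = (i, ρ a)`. -/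
theorem colProbe_equivariant (g : ℕ) (I : Fin r → Fin m) (hI : ∀ k, (I k : ℕ) + g < m) :
    ∀ ρ ∈ pointStabiliserBudget m g, ∃ θ : Equiv.Perm (Fin m), ∀ (a : Fin m) (k : Fin r),
      (ρ (I k, a).1, ρ (I k, a).2) = (I k, θ a) :=
  fun ρ hρ => ⟨ρ, fun _ k => Prod.ext (hρ (I k) (hI k)) rfl⟩

end PairProbes

section Targets

variable {m n : ℕ}

/-- A gate-free input circuit `x ↦ x q` is symmetric under every `Γ` fixing both coordinates of `q`. -/
theorem input_isSymmetricUnder_of_fixed (Γ : Set (Equiv.Perm (Fin m))) (q : Fin m × Fin m)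
    (hq : ∀ ρ ∈ Γ, ρ q.1 = q.1 ∧ ρ q.2 = q.2) : (Circuit.input q).IsSymmetricUnder Γ := by
  intro ρ hρ
  refine ⟨1, ?_, fun j => absurd j.2 (Nat.not_lt_zero _)⟩
  show Sum.inl (ρ q.1, ρ q.2) = Sum.inl q
  rw [(hq ρ hρ).1, (hq ρ hρ).2]

/-- **T0.** A fooling pair agrees on every entry both of whose coordinates are fixed by `Γ`
(input wires are symmetric circuits of size `0`); for `Γ = Bud(m, g)`: on the ordered × ordered
block. -/
theorem apply_eq_of_fools {Γ : Set (Equiv.Perm (Fin m))} {s : ℕ} {x y : Fin m × Fin m → Bool}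
    (hf : ∀ C : Circuit (Fin m × Fin m), C.IsOver tcBasis → C.size ≤ s → C.IsSymmetricUnder Γ →
      C.eval x = C.eval y)
    (q : Fin m × Fin m) (hq : ∀ ρ ∈ Γ, ρ q.1 = q.1 ∧ ρ q.2 = q.2) : x q = y q := by
  have hO : (Circuit.input q).IsOver tcBasis := fun g hg => by simp [Circuit.input] at hg
  simpa using hf (Circuit.input q) hO (Nat.zero_le _) (input_isSymmetricUnder_of_fixed Γ q hq)

/-- **T1 (probe counts).** A pair fooling the `Γ`-symmetric threshold circuits with `n + 3` gates
has the same number of indices passing any `Γ`-equivariant probe test on `n` indices. -/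
theorem probeCount_eq_of_fools {r : ℕ} {Γ : Set (Equiv.Perm (Fin m))} {s : ℕ} (hs : n + 3 ≤ s)
    {x y : Fin m × Fin m → Bool}
    (hf : ∀ C : Circuit (Fin m × Fin m), C.IsOver tcBasis → C.size ≤ s → C.IsSymmetricUnder Γ →
      C.eval x = C.eval y)
    (P : Fin n → Fin r → Fin m × Fin m)
    (hP : ∀ ρ ∈ Γ, ∃ θ : Equiv.Perm (Fin n), ∀ (a : Fin n) (k : Fin r),
      (ρ (P a k).1, ρ (P a k).2) = P (θ a) k) :
    probeCount P x = probeCount P y := by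
  have key : ∀ t, decide (t ≤ probeCount P x) = decide (t ≤ probeCount P y) := fun t => by
    rw [← probeCircuit_eval P t x, ← probeCircuit_eval P t y]
    exact hf _ (probeCircuit_isOver P t) ((size_probeCircuit P t).le.trans hs)
      (probeCircuit_isSymmetricUnder P t Γ hP)
  refine le_antisymm ?_ ?_
  · have h := key (probeCount P x)
    rw [decide_eq_true (le_refl (probeCount P x))] at h
    exact of_decide_eq_true h.symm
  · have h := key (probeCount P y)
    rw [decide_eq_true (le_refl (probeCount P y))] at h
    exact of_decide_eq_true h

/-- **T2, rows (attachment statistics are forced).** If `(x, y)` fools the `Bud(m,g)`-symmetric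
threshold circuits with `m + 3` gates then, for every tuple `I` of ordered vertices (`i + g < m`),
`x` and `y` have the same number of vertices `a` with `x (a, i) = 1` for all `i ∈ I`. By Möbius
inversion over `I` the two inputs have the same MULTISET of attachment vectors of their free
vertices to the ordered part. -/
theorem rowAttachmentCount_eq_of_fools {g s r : ℕ} (hs : m + 3 ≤ s) {x y : Fin m × Fin m → Bool}
    (hf : ∀ C : Circuit (Fin m × Fin m), C.IsOver tcBasis → C.size ≤ s →
      C.IsSymmetricUnder (pointStabiliserBudget m g) → C.eval x = C.eval y)
    (I : Fin r → Fin m) (hI : ∀ k, (I k : ℕ) + g < m) :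
    GateFn.numOnes (fun a : Fin m => decide (∀ k, x (a, I k) = true)) =
      GateFn.numOnes (fun a : Fin m => decide (∀ k, y (a, I k) = true)) :=
  probeCount_eq_of_fools hs hf (fun a k => (a, I k)) (rowProbe_equivariant g I hI)

/-- **T2, columns.** The same for the column attachments `x (i, a)`, `i ∈ I` ordered. -/
theorem colAttachmentCount_eq_of_fools {g s r : ℕ} (hs : m + 3 ≤ s) {x y : Fin m × Fin m → Bool}
    (hf : ∀ C : Circuit (Fin m × Fin m), C.IsOver tcBasis → C.size ≤ s →
      C.IsSymmetricUnder (pointStabiliserBudget m g) → C.eval x = C.eval y)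
    (I : Fin r → Fin m) (hI : ∀ k, (I k : ℕ) + g < m) :
    GateFn.numOnes (fun a : Fin m => decide (∀ k, x (I k, a) = true)) =
      GateFn.numOnes (fun a : Fin m => decide (∀ k, y (I k, a) = true)) :=
  probeCount_eq_of_fools hs hf (fun a k => (I k, a)) (colProbe_equivariant g I hI)

/-- **T2, diagonal.** The diagonal probe `a ↦ (a, a)` is equivariant under every permutation, so a
fooling pair has the same number of `1`s on the diagonal (loops — invisible to the graph `Gr x`,
visible to circuits reading the matrix). -/
theorem diagCount_eq_of_fools {Γ : Set (Equiv.Perm (Fin m))} {s : ℕ} (hs : m + 3 ≤ s)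
    {x y : Fin m × Fin m → Bool}
    (hf : ∀ C : Circuit (Fin m × Fin m), C.IsOver tcBasis → C.size ≤ s → C.IsSymmetricUnder Γ →
      C.eval x = C.eval y) :
    GateFn.numOnes (fun a : Fin m => decide (∀ _k : Fin 1, x (a, a) = true)) =
      GateFn.numOnes (fun a : Fin m => decide (∀ _k : Fin 1, y (a, a) = true)) :=
  probeCount_eq_of_fools hs hf (fun a _ => (a, a)) (fun ρ _ => ⟨ρ, fun _ _ => rfl⟩)

/-- **T3 (labelled pair statistics are forced).** A pair fooling the `Γ`-symmetric threshold
circuits with `m² + 3` gates has, for every equivariant pair-probe family `Q`, the same number of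
ordered pairs of vertices all of whose probes fire. -/
theorem pairCount_eq_of_fools {r : ℕ} {Γ : Set (Equiv.Perm (Fin m))} {s : ℕ} (hs : m * m + 3 ≤ s)
    {x y : Fin m × Fin m → Bool}
    (hf : ∀ C : Circuit (Fin m × Fin m), C.IsOver tcBasis → C.size ≤ s → C.IsSymmetricUnder Γ →
      C.eval x = C.eval y)
    (Q : Fin m × Fin m → Fin r → Fin m × Fin m)
    (hQ : ∀ ρ ∈ Γ, ∀ (q : Fin m × Fin m) (k : Fin r), (ρ (Q q k).1, ρ (Q q k).2) = Q (ρ q.1, ρ q.2) k) :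
    (Finset.univ.filter fun q : Fin m × Fin m => ∀ k, x (Q q k) = true).card =
      (Finset.univ.filter fun q : Fin m × Fin m => ∀ k, y (Q q k) = true).card := by
  rw [← probeCount_pairProbe, ← probeCount_pairProbe]
  exact probeCount_eq_of_fools hs hf (pairProbe Q) (pairProbe_equivariant Γ Q hQ)

/-- **T3, labelled edges.** In particular (`Γ = Bud(m, g)`, size budget `m² + 3`): for all tuples
`I`, `J` of ordered vertices, `x` and `y` have the same number of ordered pairs `(a, b)` with
`x (a, b) = 1`, `x (a, i) = 1` for all `i ∈ I` and `x (b, j) = 1` for all `j ∈ J`. With T2 and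
Möbius inversion: twin-free pairs (pairwise distinct attachment vectors on the free part) are
separated at size `m² + 3`; S4 witnesses fool only through twin classes of the ordered-part
equivalence. -/
theorem labelledEdgeCount_eq_of_fools {g s r₁ r₂ : ℕ} (hs : m * m + 3 ≤ s)
    {x y : Fin m × Fin m → Bool}
    (hf : ∀ C : Circuit (Fin m × Fin m), C.IsOver tcBasis → C.size ≤ s →
      C.IsSymmetricUnder (pointStabiliserBudget m g) → C.eval x = C.eval y)
    (I : Fin r₁ → Fin m) (J : Fin r₂ → Fin m)
    (hI : ∀ k, (I k : ℕ) + g < m) (hJ : ∀ k, (J k : ℕ) + g < m) :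
    (Finset.univ.filter fun q : Fin m × Fin m => ∀ k, x (edgeProbe I J q k) = true).card =
      (Finset.univ.filter fun q : Fin m × Fin m => ∀ k, y (edgeProbe I J q k) = true).card :=
  pairCount_eq_of_fools hs hf (edgeProbe I J) (edgeProbe_equivariant g I J hI hJ)

end Targets


/-! ### Permutations: `τ ⊕ id` and `τ ⊕ σ` -/

section Perms

/-- `relabelGate` of a composite permutation. -/
theorem relabelGate_trans {N : ℕ} (θ₁ θ₂ : Equiv.Perm (Fin N)) (k : ℕ) :
    Circuit.relabelGate (θ₁.trans θ₂) k = Circuit.relabelGate θ₂ (Circuit.relabelGate θ₁ k) := by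
  by_cases hk : k < N
  · rw [Circuit.relabelGate_of_lt _ hk, Circuit.relabelGate_of_lt θ₁ hk,
      Circuit.relabelGate_of_lt θ₂ (θ₁ ⟨k, hk⟩).2, Equiv.trans_apply]
  · rw [Circuit.relabelGate_of_le _ (not_lt.1 hk), Circuit.relabelGate_of_le θ₁ (not_lt.1 hk),
      Circuit.relabelGate_of_le θ₂ (not_lt.1 hk)]

/-- **`τ ⊕ id`.** A permutation of the first `L` indices extended by the identity above `L`. -/
theorem exists_extendPerm {N L : ℕ} (hL : L ≤ N) (τ : Equiv.Perm (Fin L)) :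
    ∃ θ : Equiv.Perm (Fin N), ∀ k : ℕ,
      Circuit.relabelGate θ k = if k < L then Circuit.relabelGate τ k else k := by
  have hlt : ∀ (η : Equiv.Perm (Fin L)) {v : ℕ}, v < N →
      (if v < L then Circuit.relabelGate η v else v) < N := by
    intro η v hv
    split_ifs with h
    · exact (Circuit.relabelGate_lt η h).trans_le hL
    · exact hv
  have hinv : ∀ (η : Equiv.Perm (Fin L)) {v : ℕ}, v < N →
      (if (if v < L then Circuit.relabelGate η v else v) < L then
          Circuit.relabelGate η.symm (if v < L then Circuit.relabelGate η v else v)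
        else (if v < L then Circuit.relabelGate η v else v)) = v := by
    intro η v hv
    by_cases h : v < L
    · simp only [if_pos h, if_pos (Circuit.relabelGate_lt η h)]
      exact relabelGate_symm_relabelGate η h
    · simp only [if_neg h]
  refine ⟨⟨fun i => ⟨if (i : ℕ) < L then Circuit.relabelGate τ i else i, hlt τ i.2⟩,
    fun i => ⟨if (i : ℕ) < L then Circuit.relabelGate τ.symm i else i, hlt τ.symm i.2⟩,
    fun i => Fin.ext (hinv τ i.2),
    fun i => Fin.ext (by simpa only [Equiv.symm_symm] using hinv τ.symm i.2)⟩, fun k => ?_⟩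
  by_cases hk : k < N
  · rw [Circuit.relabelGate_of_lt _ hk]
    rfl
  · have h1 : ¬ k < L := by omega
    rw [Circuit.relabelGate_of_le _ (not_lt.1 hk), if_neg h1]

/-- **`τ ⊕ σ`.** `τ` on the first `L` indices, `σ` shifted by `L` on the next `n`. -/
theorem exists_sumPerm {N L n : ℕ} (hN : N = n + L) (τ : Equiv.Perm (Fin L)) (σ : Equiv.Perm (Fin n)) :
    ∃ θ : Equiv.Perm (Fin N), ∀ k : ℕ,
      Circuit.relabelGate θ k =
        if k < L then Circuit.relabelGate τ k else Circuit.relabelGate σ (k - L) + L := by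
  obtain ⟨θ₁, h₁⟩ := exists_extendPerm (by omega : L ≤ N) τ
  obtain ⟨θ₂, h₂⟩ := exists_liftPerm L hN σ
  refine ⟨θ₁.trans θ₂, fun k => ?_⟩
  rw [relabelGate_trans, h₁]
  by_cases hk : k < L
  · rw [if_pos hk, h₂, if_pos (Circuit.relabelGate_lt τ hk), if_pos hk]
  · rw [if_neg hk, h₂, if_neg hk, if_neg hk]

variable {ι : Type*}

/-- Two relabellings that agree on gate indices `< L` agree on every wire referring below `L`. -/
theorem relabelWire_eq_of_refs_lt {n N L : ℕ} (π : ι → ι) (τ : Equiv.Perm (Fin n))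
    (θ : Equiv.Perm (Fin N)) (hθ : ∀ k, k < L → Circuit.relabelGate θ k = Circuit.relabelGate τ k)
    (w : ι ⊕ ℕ) (hw : ∀ k, w = Sum.inr k → k < L) :
    Circuit.relabelWire π θ w = Circuit.relabelWire π τ w := by
  cases w with
  | inl i => rfl
  | inr k => simp only [Circuit.relabelWire_inr, hθ k (hw k rfl)]

/-- The argument list of gate `j` of a well-formed program refers only below `j`. -/
theorem refs_lt_of_wf {gs : List (Gate ι)} (hwf : WF gs) {j : ℕ} (hj : j < gs.length)
    {w : ι ⊕ ℕ} (hw : w ∈ List.ofFn (gs[j]).args) (k : ℕ) (hk : w = Sum.inr k) : k < j := by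
  obtain ⟨a, rfl⟩ := List.mem_ofFn.1 hw
  exact hwf j (gs[j]) (List.getElem?_eq_getElem hj) a k hk

end Perms

/-! ### Relocating a circuit behind a symmetric prefix along an equivariant wiring (`τ ⊕ σ`) -/

section Top

variable {ι ι' : Type*}

/-- The composite program exists as a `Circuit`. -/
theorem exists_top (gs : List (Gate ι)) (hwf : WF gs) (D : Circuit ι') (φ : ι' → ι ⊕ ℕ)
    (hφ : WiresOK gs.length φ) :
    ∃ E : Circuit ι, E.gates = gs ++ D.gates.map (reloc φ gs.length) ∧
      E.output = shiftWire φ gs.length D.output := by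
  have hout : WiresOK D.gates.length (fun _ : Unit => D.output) := fun _ k hk => D.wf_output k hk
  have ho := wiresOK_shiftWire hφ hout
  refine ⟨toCircuit (gs ++ D.gates.map (reloc φ gs.length)) (shiftWire φ gs.length D.output)
    (hwf.append_reloc (wf_gates D) hφ) (fun k hk => ?_), rfl, rfl⟩
  have := ho () k hk
  simp only [List.length_append, List.length_map]
  exact this

/-- The composite computes `D` on the values carried by the wires `φ`. -/
theorem eval_top (gs : List (Gate ι)) (D : Circuit ι') (φ : ι' → ι ⊕ ℕ) (hφ : WiresOK gs.length φ)
    (E : Circuit ι) (hEg : E.gates = gs ++ D.gates.map (reloc φ gs.length))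
    (hEo : E.output = shiftWire φ gs.length D.output) (x : ι → Bool) :
    E.eval x = D.eval (fun i => wireOf x (vals gs x) (φ i)) := by
  rw [circuit_eval, circuit_eval, hEg, hEo, vals_append_reloc gs D.gates φ hφ x,
    wireOf_shiftWire x _ _ (length_vals gs x) φ hφ]

/-- The composite is over any basis containing the prefix gates and the gates of `D`. -/
theorem isOver_top {B : Set GateFn} (gs : List (Gate ι)) (hgs : ∀ g ∈ gs, g.fn ∈ B)
    (D : Circuit ι') (hD : D.IsOver B) (φ : ι' → ι ⊕ ℕ) (L : ℕ) (E : Circuit ι)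
    (hEg : E.gates = gs ++ D.gates.map (reloc φ L)) : E.IsOver B := by
  intro g hg
  rw [hEg, List.mem_append, List.mem_map] at hg
  rcases hg with hg | ⟨g', hg', rfl⟩
  · exact hgs g hg
  · rw [reloc_fn]
    exact hD g' hg'

/-- The composite has `|gs| + |D|` gates. -/
theorem size_top (gs : List (Gate ι)) (D : Circuit ι') (φ : ι' → ι ⊕ ℕ) (L : ℕ) (E : Circuit ι)
    (hEg : E.gates = gs ++ D.gates.map (reloc φ L)) : E.size = D.size + gs.length := by
  simp only [Circuit.size, hEg, List.length_append, List.length_map]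
  omega

/-- **`τ ⊕ σ` along an equivariant wiring** — the general composition lemma. Let the program
`gs' = gs ++ D.gates.map (reloc φ |gs|)` relocate a circuit `D` (inputs `ι'`) behind `gs` along the
wiring `φ : ι' → wires of gs`. If `τ` satisfies the gate conditions of an induced automorphism on
`gs` (extending the variable map `π`), `σ` is an automorphism of `D` extending `π' : ι' → ι'`, and the
wiring INTERTWINES the two, `relabelWire π τ (φ i) = φ (π' i)`, then `τ ⊕ σ` satisfies the gate
conditions on `gs'` (extending `π`), agrees with `τ` below `|gs|`, and fixes the shifted output of `D`.
Special cases: `π' = id, σ = 1` (hard-wiring ANY circuit onto `τ`-fixed wires: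
`exists_isInducedAut_top`) and `φ = inl, π' = π` (appending a symmetric circuit: `exists_snocPerm`). -/
theorem exists_relocPerm (gs : List (Gate ι)) (hwf : WF gs) (D : Circuit ι') (φ : ι' → ι ⊕ ℕ)
    (hφ : WiresOK gs.length φ) (π : ι → ι) (τ : Equiv.Perm (Fin gs.length))
    (haut : ∀ j : Fin gs.length, (gs[τ j]).fn = (gs[j]).fn ∧
      (List.ofFn (gs[τ j]).args).Perm ((List.ofFn (gs[j]).args).map (Circuit.relabelWire π τ)))
    (π' : ι' → ι') (σ : Equiv.Perm (Fin D.gates.length)) (hσ : D.IsInducedAut π' σ)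
    (hφπ : ∀ i, Circuit.relabelWire π τ (φ i) = φ (π' i))
    (gs' : List (Gate ι)) (hgs' : gs' = gs ++ D.gates.map (reloc φ gs.length)) :
    ∃ θ : Equiv.Perm (Fin gs'.length),
      (∀ k, k < gs.length → Circuit.relabelGate θ k = Circuit.relabelGate τ k) ∧
      Circuit.relabelWire π θ (shiftWire φ gs.length D.output) = shiftWire φ gs.length D.output ∧
      ∀ j : Fin gs'.length, (gs'[θ j]).fn = (gs'[j]).fn ∧
        (List.ofFn (gs'[θ j]).args).Perm ((List.ofFn (gs'[j]).args).map (Circuit.relabelWire π θ)) := by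
  subst hgs'
  have hN : (gs ++ D.gates.map (reloc φ gs.length)).length = D.gates.length + gs.length := by
    simp only [List.length_append, List.length_map]
    omega
  obtain ⟨θ, hθ⟩ := exists_sumPerm hN τ σ
  have hagree : ∀ k, k < gs.length → Circuit.relabelGate θ k = Circuit.relabelGate τ k :=
    fun k hk => by rw [hθ, if_pos hk]
  -- the key identity: relabelling by `(π, θ)` after shifting = shifting after relabelling by `(π', σ)`
  have hcomm : ∀ w : ι' ⊕ ℕ, Circuit.relabelWire π θ (shiftWire φ gs.length w) =
      shiftWire φ gs.length (Circuit.relabelWire π' σ w) := by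
    intro w
    cases w with
    | inl i =>
      show Circuit.relabelWire π θ (φ i) = φ (π' i)
      rw [relabelWire_eq_of_refs_lt π τ θ hagree (φ i) (fun k hk => hφ i k hk), hφπ i]
    | inr k =>
      show Circuit.relabelWire π θ (Sum.inr (k + gs.length)) =
        Sum.inr (Circuit.relabelGate σ k + gs.length)
      rw [Circuit.relabelWire_inr, hθ, if_neg (by omega), Nat.add_sub_cancel]
  refine ⟨θ, hagree, by rw [hcomm, hσ.1], ?_⟩
  rintro ⟨j, hj⟩
  simp only [Fin.getElem_fin]
  have hjv : ((θ ⟨j, hj⟩ : Fin _) : ℕ) = Circuit.relabelGate θ j :=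
    (Circuit.relabelGate_of_lt θ hj).symm
  rcases Nat.lt_or_ge j gs.length with hjL | hjL
  · -- a prefix gate: `θ` acts as `τ`, and on its wires the two relabellings agree
    have hv : ((θ ⟨j, hj⟩ : Fin _) : ℕ) = (τ ⟨j, hjL⟩ : ℕ) := by
      rw [hjv, hagree j hjL, Circuit.relabelGate_of_lt τ hjL]
    rw [getElem_congr_idx hv]
    rw [List.getElem_append_left (τ ⟨j, hjL⟩).2, List.getElem_append_left hjL]
    obtain ⟨hfn, hperm⟩ := haut ⟨j, hjL⟩
    simp only [Fin.getElem_fin] at hfn hperm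
    refine ⟨hfn, ?_⟩
    have hmap : (List.ofFn (gs[j]).args).map (Circuit.relabelWire π θ) =
        (List.ofFn (gs[j]).args).map (Circuit.relabelWire π τ) :=
      List.map_congr_left fun w hw => relabelWire_eq_of_refs_lt π τ θ hagree w
        (fun k hk => (refs_lt_of_wf hwf hjL hw k hk).trans hjL)
    rw [hmap]
    exact hperm
  · -- a relocated gate `k + |gs|` of `D`: goes to `σ k + |gs|`
    obtain ⟨k, rfl⟩ : ∃ k, j = k + gs.length := ⟨j - gs.length, by omega⟩
    have hk : k < D.gates.length := by
      rw [hN] at hj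
      omega
    have hv : ((θ ⟨k + gs.length, hj⟩ : Fin _) : ℕ) = (σ ⟨k, hk⟩ : ℕ) + gs.length := by
      rw [hjv, hθ, if_neg (by omega), Nat.add_sub_cancel, Circuit.relabelGate_of_lt σ hk]
    rw [getElem_congr_idx hv]
    rw [getElem_append_map_add gs D.gates (reloc φ gs.length) (σ ⟨k, hk⟩) (σ ⟨k, hk⟩).2,
      getElem_append_map_add gs D.gates (reloc φ gs.length) k hk]
    obtain ⟨hfn, hperm⟩ := hσ.2 ⟨k, hk⟩
    simp only [Fin.getElem_fin] at hfn hperm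
    refine ⟨by rw [reloc_fn, reloc_fn]; exact hfn, ?_⟩
    rw [ofFn_reloc_args, ofFn_reloc_args]
    have hmm : ((List.ofFn (D.gates[k]).args).map (Circuit.relabelWire π' σ)).map
          (shiftWire φ gs.length) =
        ((List.ofFn (D.gates[k]).args).map (shiftWire φ gs.length)).map
          (Circuit.relabelWire π θ) := by
      rw [List.map_map, List.map_map]
      exact List.map_congr_left fun w _ => (hcomm w).symm
    rw [← hmm]
    exact hperm.map _

/-- **`τ ⊕ id` is an automorphism of the composite.** If `τ` satisfies the gate conditions on the
prefix `gs` (extending the variable map `π`) and fixes every wire `φ i`, then the composite of `gs`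
with ANY circuit `D` hard-wired onto the wires `φ` has the automorphism `τ ⊕ id` extending `π`. -/
theorem exists_isInducedAut_top (gs : List (Gate ι)) (hwf : WF gs) (D : Circuit ι')
    (φ : ι' → ι ⊕ ℕ) (hφ : WiresOK gs.length φ) (E : Circuit ι)
    (hEg : E.gates = gs ++ D.gates.map (reloc φ gs.length))
    (hEo : E.output = shiftWire φ gs.length D.output)
    (π : ι → ι) (τ : Equiv.Perm (Fin gs.length))
    (hfix : ∀ i, Circuit.relabelWire π τ (φ i) = φ i)
    (haut : ∀ j : Fin gs.length, (gs[τ j]).fn = (gs[j]).fn ∧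
      (List.ofFn (gs[τ j]).args).Perm ((List.ofFn (gs[j]).args).map (Circuit.relabelWire π τ))) :
    ∃ θ : Equiv.Perm (Fin E.gates.length), E.IsInducedAut π θ := by
  obtain ⟨Eg, Eo, hEwf, hEo'⟩ := E
  dsimp only at hEg hEo
  subst hEg hEo
  obtain ⟨θ, -, hout, hgates⟩ := exists_relocPerm gs hwf D φ hφ π τ haut _root_.id 1
    (Circuit.isInducedAut_id_one D) hfix _ rfl
  exact ⟨θ, hout, hgates⟩

/-- **Hard-wiring onto a symmetric prefix is symmetric (matrix inputs).** If every `ρ ∈ Γ` extends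
to a gate permutation of the prefix satisfying the gate conditions and fixing the wires `φ i`, then
the composite with any `D` is `Γ`-symmetric. -/
theorem isSymmetricUnder_top {m : ℕ} (Γ : Set (Equiv.Perm (Fin m)))
    (gs : List (Gate (Fin m × Fin m))) (hwf : WF gs) (D : Circuit ι')
    (φ : ι' → (Fin m × Fin m) ⊕ ℕ) (hφ : WiresOK gs.length φ) (E : Circuit (Fin m × Fin m))
    (hEg : E.gates = gs ++ D.gates.map (reloc φ gs.length))
    (hEo : E.output = shiftWire φ gs.length D.output)
    (hsym : ∀ ρ ∈ Γ, ∃ τ : Equiv.Perm (Fin gs.length),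
      (∀ i, Circuit.relabelWire (fun q : Fin m × Fin m => (ρ q.1, ρ q.2)) τ (φ i) = φ i) ∧
      ∀ j : Fin gs.length, (gs[τ j]).fn = (gs[j]).fn ∧
        (List.ofFn (gs[τ j]).args).Perm ((List.ofFn (gs[j]).args).map
          (Circuit.relabelWire (fun q : Fin m × Fin m => (ρ q.1, ρ q.2)) τ))) :
    E.IsSymmetricUnder Γ := by
  intro ρ hρ
  obtain ⟨τ, hfix, haut⟩ := hsym ρ hρ
  exact exists_isInducedAut_top gs hwf D φ hφ E hEg hEo _ τ hfix haut

end Top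

/-! ### Appending a symmetric circuit to a symmetric prefix (`τ ⊕ σ`) -/

section Snoc

variable {ι : Type*}

/-- The prefix extended by `C` (relocated behind `gs`, reading the inputs directly) is well formed. -/
theorem wf_snoc (gs : List (Gate ι)) (hwf : WF gs) (C : Circuit ι) :
    WF (gs ++ C.gates.map (reloc Sum.inl gs.length)) :=
  hwf.append_reloc (wf_gates C) (wiresOK_inl gs.length _root_.id)

/-- Its new designated wire, the shifted output of `C`, is a valid wire. -/
theorem snocOut_lt (gs : List (Gate ι)) (C : Circuit ι) (k : ℕ)
    (hk : shiftWire (Sum.inl : ι → ι ⊕ ℕ) gs.length C.output = Sum.inr k) :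
    k < (gs ++ C.gates.map (reloc Sum.inl gs.length)).length := by
  cases hC : C.output with
  | inl i => rw [hC] at hk; cases hk
  | inr k' =>
    rw [hC] at hk
    simp only [shiftWire, Sum.inr.injEq] at hk
    have := C.wf_output k' hC
    simp only [List.length_append, List.length_map]
    omega

/-- The values of the extended prefix: those of `gs`, then those of `C`; in particular the new
designated wire carries `C.eval x` and the old wires keep their values. -/
theorem vals_snoc (gs : List (Gate ι)) (C : Circuit ι) (x : ι → Bool) :
    vals (gs ++ C.gates.map (reloc Sum.inl gs.length)) x = vals gs x ++ vals C.gates x := by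
  rw [vals_append_reloc gs C.gates Sum.inl (wiresOK_inl gs.length _root_.id) x]
  rfl

/-- The new designated wire of the extended prefix carries `C.eval x`. -/
theorem wireOf_snoc_new (gs : List (Gate ι)) (C : Circuit ι) (x : ι → Bool) :
    wireOf x (vals (gs ++ C.gates.map (reloc Sum.inl gs.length)) x)
      (shiftWire Sum.inl gs.length C.output) = C.eval x := by
  rw [vals_snoc, wireOf_shiftWire x _ _ (length_vals gs x) Sum.inl (wiresOK_inl gs.length _root_.id),
    circuit_eval]
  rfl

/-- Wires of the old prefix keep their values in the extended prefix. -/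
theorem wireOf_snoc_old (gs : List (Gate ι)) (C : Circuit ι) (x : ι → Bool) (w : ι ⊕ ℕ)
    (hw : ∀ k, w = Sum.inr k → k < gs.length) :
    wireOf x (vals (gs ++ C.gates.map (reloc Sum.inl gs.length)) x) w = wireOf x (vals gs x) w := by
  rw [vals_snoc]
  exact wireOf_append_of_lt x _ _ w (fun k hk => by rw [length_vals]; exact hw k hk)

/-- **`τ ⊕ σ` is an automorphism of the extended prefix.** If `τ` satisfies the gate conditions on
`gs` extending `π` and `σ` is an automorphism of `C` extending `π`, then `τ ⊕ σ` satisfies the gate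
conditions on `gs ++ C` (relocated), fixes the new designated wire (the shifted output of `C`) and
every wire below `|gs|` that `τ` fixed. -/
theorem exists_snocPerm (gs : List (Gate ι)) (hwf : WF gs) (C : Circuit ι) (π : ι → ι)
    (τ : Equiv.Perm (Fin gs.length))
    (haut : ∀ j : Fin gs.length, (gs[τ j]).fn = (gs[j]).fn ∧
      (List.ofFn (gs[τ j]).args).Perm ((List.ofFn (gs[j]).args).map (Circuit.relabelWire π τ)))
    (σ : Equiv.Perm (Fin C.gates.length)) (hσ : C.IsInducedAut π σ)
    (gs' : List (Gate ι)) (hgs' : gs' = gs ++ C.gates.map (reloc Sum.inl gs.length)) :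
    ∃ θ : Equiv.Perm (Fin gs'.length),
      (∀ k, k < gs.length → Circuit.relabelGate θ k = Circuit.relabelGate τ k) ∧
      Circuit.relabelWire π θ (shiftWire Sum.inl gs.length C.output) =
        shiftWire Sum.inl gs.length C.output ∧
      (∀ w : ι ⊕ ℕ, (∀ k, w = Sum.inr k → k < gs.length) → Circuit.relabelWire π τ w = w →
        Circuit.relabelWire π θ w = w) ∧
      ∀ j : Fin gs'.length, (gs'[θ j]).fn = (gs'[j]).fn ∧
        (List.ofFn (gs'[θ j]).args).Perm ((List.ofFn (gs'[j]).args).map (Circuit.relabelWire π θ)) := by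
  obtain ⟨θ, hagree, hout, hgates⟩ := exists_relocPerm gs hwf C Sum.inl (wiresOK_inl gs.length _root_.id)
    π τ haut π σ hσ (fun _ => rfl) gs' hgs'
  exact ⟨θ, hagree, hout, fun w hw hfix => by
    rw [relabelWire_eq_of_refs_lt π τ θ hagree w hw, hfix], hgates⟩

end Snoc


/-! ### Probe counts over a symmetric prefix -/

section Over

variable {ι : Type*} {n r : ℕ}

/-- **Probe counts over a symmetric prefix are symmetric-cheap (matrix inputs).** -/
theorem hasSymCircuit_probeCount_over {m : ℕ} (Γ : Set (Equiv.Perm (Fin m)))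
    (gs : List (Gate (Fin m × Fin m))) (hwf : WF gs) (hB : ∀ g ∈ gs, g.fn ∈ tcBasis)
    (W : Fin n → Fin r → (Fin m × Fin m) ⊕ ℕ) (hW : ∀ c k j, W c k = Sum.inr j → j < gs.length)
    (hsym : ∀ ρ ∈ Γ, ∃ τ : Equiv.Perm (Fin gs.length), ∃ θ : Equiv.Perm (Fin n),
      (∀ c k, Circuit.relabelWire (fun q : Fin m × Fin m => (ρ q.1, ρ q.2)) τ (W c k) = W (θ c) k) ∧
      ∀ j : Fin gs.length, (gs[τ j]).fn = (gs[j]).fn ∧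
        (List.ofFn (gs[τ j]).args).Perm ((List.ofFn (gs[j]).args).map
          (Circuit.relabelWire (fun q : Fin m × Fin m => (ρ q.1, ρ q.2)) τ)))
    (t : ℕ) :
    HasSymCircuit tcBasis Γ (gs.length + (n + 3))
      (fun x => decide (t ≤ GateFn.numOnes fun c : Fin n =>
        decide (∀ k : Fin r, wireOf x (vals gs x) (W c k) = true))) := by
  -- the abstract probe block: inputs `Fin n × Fin r`, probe `(c, k) ↦ (c, k)`
  set D : Circuit (Fin n × Fin r) := probeCircuit (fun (c : Fin n) (k : Fin r) => (c, k)) t with hD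
  set φ : Fin n × Fin r → (Fin m × Fin m) ⊕ ℕ := fun i => W i.1 i.2 with hφ
  have hφok : WiresOK gs.length φ := fun i j hj => hW i.1 i.2 j hj
  obtain ⟨E, hEg, hEo⟩ := exists_top gs hwf D φ hφok
  refine ⟨E, isOver_top gs hB D (probeCircuit_isOver _ t) φ gs.length E hEg, ?_, ?_, ?_⟩
  · rw [size_top gs D φ gs.length E hEg, size_probeCircuit]
    omega
  · intro ρ hρ
    obtain ⟨τ, θ, hWθ, haut⟩ := hsym ρ hρ
    -- `θ × id` on the abstract inputs is an automorphism of the probe block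
    obtain ⟨σ, hσ⟩ := probeCircuit_isInducedAut (fun (c : Fin n) (k : Fin r) => (c, k)) t
      (fun i : Fin n × Fin r => (θ i.1, i.2)) θ (fun _ _ => rfl)
    obtain ⟨Eg, Eo, hEwf, hEo'⟩ := E
    dsimp only at hEg hEo
    subst hEg hEo
    obtain ⟨ζ, -, hout, hgates⟩ := exists_relocPerm gs hwf D φ hφok _ τ haut
      (fun i : Fin n × Fin r => (θ i.1, i.2)) σ hσ (fun i => hWθ i.1 i.2) _ rfl
    exact ⟨ζ, hout, hgates⟩
  · intro x
    rw [eval_top gs D φ hφok E hEg hEo x, hD, probeCircuit_eval]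
    rfl

end Over

/-! ### The negation layer and literal wires -/

section NegLayer

variable {m : ℕ}

/-- The negation gate `¬ x q`. -/
def negGate (q : Fin m × Fin m) : Gate (Fin m × Fin m) := ⟨1, GateFn.not.2, fun _ => Sum.inl q⟩

/-- The negation layer: gate `finProdFinEquiv q` is `¬ x q`. -/
def negLayer (m : ℕ) : List (Gate (Fin m × Fin m)) :=
  List.ofFn fun c : Fin (m * m) => negGate (finProdFinEquiv.symm c)

/-- The negation layer has `m²` gates. -/
@[simp] theorem length_negLayer (m : ℕ) : (negLayer m).length = m * m := by simp [negLayer]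

/-- Its gates. -/
theorem negLayer_getElem (c : ℕ) (hc : c < (negLayer m).length) :
    (negLayer m)[c] = negGate (finProdFinEquiv.symm ⟨c, by simpa using hc⟩) := by
  simp [negLayer]

/-- The negation layer reads inputs only, so it is well formed. -/
theorem wf_negLayer (m : ℕ) : WF (negLayer m) := by
  intro j g hj a k hk
  obtain ⟨c, hc⟩ : ∃ c, negGate (finProdFinEquiv.symm c) = g :=
    List.mem_ofFn.1 (List.mem_iff_getElem?.2 ⟨j, hj⟩)
  subst hc
  simp [negGate] at hk

/-- The negation layer is over `tcBasis`. -/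
theorem negLayer_isOver (m : ℕ) : ∀ g ∈ negLayer m, g.fn ∈ tcBasis := by
  intro g hg
  obtain ⟨c, rfl⟩ := List.mem_ofFn.1 hg
  exact not_mem_tcBasis

/-- Values of the negation layer: gate `finProdFinEquiv q` carries `¬ x q`. -/
theorem vals_negLayer_getD (x : Fin m × Fin m → Bool) (q : Fin m × Fin m) :
    (vals (negLayer m) x).getD (finProdFinEquiv q) false = !(x q) := by
  have hwf := wf_negLayer m
  set C : Circuit (Fin m × Fin m) := toCircuit (negLayer m) (Sum.inl q) hwf (fun k hk => by cases hk)
    with hC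
  have hq : ((finProdFinEquiv q : Fin (m * m)) : ℕ) < (negLayer m).length := by
    rw [length_negLayer]
    exact (finProdFinEquiv q).2
  have h1 : vals (negLayer m) x = transcript x [] C.gates :=
    (circuit_wireVals C x).symm.trans (wireVals_eq_transcript C x)
  rw [h1, getD_transcript_eq_gateValue C x _ hq]
  show gateValue x (transcript x [] C.gates) ((negLayer m)[(finProdFinEquiv q : ℕ)]) = _
  rw [negLayer_getElem]
  simp only [Fin.eta, Equiv.symm_apply_apply]
  rfl

/-- **The literal wire** `lit q b`: the input `x q` itself if `b = true`, its negation gate otherwise. -/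
def lit (q : Fin m × Fin m) (b : Bool) : (Fin m × Fin m) ⊕ ℕ :=
  if b then Sum.inl q else Sum.inr (finProdFinEquiv q)

/-- A literal wire refers below `m²`. -/
theorem lit_lt (q : Fin m × Fin m) (b : Bool) (j : ℕ) (h : lit q b = Sum.inr j) :
    j < (negLayer m).length := by
  unfold lit at h
  split_ifs at h with hb
  cases h
  rw [length_negLayer]
  exact (finProdFinEquiv q).2

/-- **The literal wire carries `[x q = b]`.** -/
theorem wireOf_lit (x : Fin m × Fin m → Bool) (q : Fin m × Fin m) (b : Bool) :
    wireOf x (vals (negLayer m) x) (lit q b) = decide (x q = b) := by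
  unfold lit
  cases b
  · simp only [Bool.false_eq_true, ↓reduceIte, wireOf_inr, vals_negLayer_getD]
    cases x q <;> rfl
  · simp only [↓reduceIte, wireOf_inl]
    cases x q <;> rfl

/-- The gate permutation of the negation layer induced by a vertex permutation `ρ`. -/
def negPerm (ρ : Equiv.Perm (Fin m)) : Equiv.Perm (Fin (m * m)) :=
  finProdFinEquiv.symm.trans ((Equiv.prodCongr ρ ρ).trans finProdFinEquiv)

theorem negPerm_apply (ρ : Equiv.Perm (Fin m)) (q : Fin m × Fin m) :
    negPerm ρ (finProdFinEquiv q) = finProdFinEquiv (ρ q.1, ρ q.2) := by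
  obtain ⟨a, b⟩ := q
  simp [negPerm]

/-- **The negation layer is symmetric under every vertex permutation**, with gate permutation
`negPerm ρ` (transported to the layer's length). -/
theorem negLayer_aut (ρ : Equiv.Perm (Fin m)) :
    ∃ τ : Equiv.Perm (Fin (negLayer m).length),
      (∀ q : Fin m × Fin m, Circuit.relabelGate τ (finProdFinEquiv q) = finProdFinEquiv (ρ q.1, ρ q.2)) ∧
      ∀ j : Fin (negLayer m).length, ((negLayer m)[τ j]).fn = ((negLayer m)[j]).fn ∧
        (List.ofFn ((negLayer m)[τ j]).args).Perm ((List.ofFn ((negLayer m)[j]).args).map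
          (Circuit.relabelWire (fun q : Fin m × Fin m => (ρ q.1, ρ q.2)) τ)) := by
  have hlen : (negLayer m).length = m * m := length_negLayer m
  -- transport `negPerm ρ` along `hlen`
  let e : Fin (negLayer m).length ≃ Fin (m * m) := finCongr hlen
  refine ⟨(e.trans (negPerm ρ)).trans e.symm, fun q => ?_, ?_⟩
  · rw [Circuit.relabelGate_of_lt _ (by rw [hlen]; exact (finProdFinEquiv q).2)]
    show (((negPerm ρ) (e ⟨(finProdFinEquiv q : ℕ), _⟩)).1 : ℕ) = _
    have : e ⟨(finProdFinEquiv q : ℕ), by rw [hlen]; exact (finProdFinEquiv q).2⟩ = finProdFinEquiv q :=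
      Fin.ext rfl
    rw [this, negPerm_apply]
  · rintro ⟨j, hj⟩
    have hj' : j < m * m := hlen ▸ hj
    set q : Fin m × Fin m := finProdFinEquiv.symm ⟨j, hj'⟩ with hq
    have hjq : (⟨j, hj'⟩ : Fin (m * m)) = finProdFinEquiv q := by rw [hq, Equiv.apply_symm_apply]
    simp only [Fin.getElem_fin]
    have hv : ((((e.trans (negPerm ρ)).trans e.symm) ⟨j, hj⟩ : Fin _) : ℕ) =
        ((finProdFinEquiv (ρ q.1, ρ q.2) : Fin (m * m)) : ℕ) := by
      show (((negPerm ρ) (e ⟨j, hj⟩)).1 : ℕ) = _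
      have : e ⟨j, hj⟩ = finProdFinEquiv q := by rw [← hjq]; exact Fin.ext rfl
      rw [this, negPerm_apply]
    rw [getElem_congr_idx hv]
    rw [negLayer_getElem, negLayer_getElem]
    refine ⟨rfl, ?_⟩
    rw [List.map_ofFn]
    refine List.Perm.of_eq (congrArg List.ofFn (funext fun i => ?_))
    show (Sum.inl (finProdFinEquiv.symm ⟨((finProdFinEquiv (ρ q.1, ρ q.2) : Fin (m * m)) : ℕ), _⟩) :
        (Fin m × Fin m) ⊕ ℕ) = Sum.inl (ρ q.1, ρ q.2)
    rw [Fin.eta, Equiv.symm_apply_apply]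

/-- **Literal wires are permuted by the negation layer's automorphism**:
`relabelWire (ρ × ρ) τ (lit q b) = lit (ρ • q) b`. -/
theorem relabelWire_lit (ρ : Equiv.Perm (Fin m)) (τ : Equiv.Perm (Fin (negLayer m).length))
    (hτ : ∀ q : Fin m × Fin m, Circuit.relabelGate τ (finProdFinEquiv q) = finProdFinEquiv (ρ q.1, ρ q.2))
    (q : Fin m × Fin m) (b : Bool) :
    Circuit.relabelWire (fun q : Fin m × Fin m => (ρ q.1, ρ q.2)) τ (lit q b) = lit (ρ q.1, ρ q.2) b := by
  unfold lit
  cases b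
  · simp only [Bool.false_eq_true, ↓reduceIte, Circuit.relabelWire_inr, hτ q]
  · rfl

/-- **Literal probe counts are symmetric-cheap.** For a family of matrix positions
`Q : Fin n → Fin r → Fin m × Fin m` and signs `b : Fin n → Fin r → Bool` equivariant under `Γ`
(`ρ • Q c k = Q (θ c) k`, `b c k = b (θ c) k`), the function
`x ↦ [t ≤ #{c | ∀ k, x (Q c k) = b c k}]` has a `Γ`-symmetric threshold circuit of size `m² + (n + 3)`. -/
theorem hasSymCircuit_litCount {n r : ℕ} (Γ : Set (Equiv.Perm (Fin m)))
    (Q : Fin n → Fin r → Fin m × Fin m) (b : Fin n → Fin r → Bool)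
    (hQ : ∀ ρ ∈ Γ, ∃ θ : Equiv.Perm (Fin n), ∀ c k,
      (ρ (Q c k).1, ρ (Q c k).2) = Q (θ c) k ∧ b c k = b (θ c) k) (t : ℕ) :
    HasSymCircuit tcBasis Γ (m * m + (n + 3))
      (fun x => decide (t ≤ GateFn.numOnes fun c : Fin n => decide (∀ k : Fin r, x (Q c k) = b c k))) := by
  have hsym : ∀ ρ ∈ Γ, ∃ τ : Equiv.Perm (Fin (negLayer m).length), ∃ θ : Equiv.Perm (Fin n),
      (∀ c k, Circuit.relabelWire (fun q : Fin m × Fin m => (ρ q.1, ρ q.2)) τ (lit (Q c k) (b c k)) =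
        lit (Q (θ c) k) (b (θ c) k)) ∧
      ∀ j : Fin (negLayer m).length, ((negLayer m)[τ j]).fn = ((negLayer m)[j]).fn ∧
        (List.ofFn ((negLayer m)[τ j]).args).Perm ((List.ofFn ((negLayer m)[j]).args).map
          (Circuit.relabelWire (fun q : Fin m × Fin m => (ρ q.1, ρ q.2)) τ)) := by
    intro ρ hρ
    obtain ⟨τ, hτ, haut⟩ := negLayer_aut ρ
    obtain ⟨θ, hθ⟩ := hQ ρ hρ
    refine ⟨τ, θ, fun c k => ?_, haut⟩
    rw [relabelWire_lit ρ τ hτ, (hθ c k).1, (hθ c k).2]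
  have h := hasSymCircuit_probeCount_over Γ (negLayer m) (wf_negLayer m) (negLayer_isOver m)
    (fun c k => lit (Q c k) (b c k)) (fun c k j hj => lit_lt _ _ j hj) hsym t
  have hfun : (fun x : Fin m × Fin m → Bool => decide (t ≤ GateFn.numOnes fun c : Fin n =>
        decide (∀ k : Fin r, x (Q c k) = b c k))) =
      (fun x => decide (t ≤ GateFn.numOnes fun c : Fin n =>
        decide (∀ k : Fin r, wireOf x (vals (negLayer m) x) (lit (Q c k) (b c k)) = true))) := by
    funext x
    have hin : (fun c : Fin n => decide (∀ k : Fin r, x (Q c k) = b c k)) =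
        (fun c => decide (∀ k : Fin r, wireOf x (vals (negLayer m) x) (lit (Q c k) (b c k)) = true)) :=
      funext fun c => (decide_eq_decide).2 (forall_congr' fun k => by
        rw [wireOf_lit]
        exact ⟨fun hx => decide_eq_true hx, fun hx => of_decide_eq_true hx⟩)
    rw [hin]
  rw [hfun, show m * m + (n + 3) = (negLayer m).length + (n + 3) by rw [length_negLayer]]
  exact h

end NegLayer


/-! ### T2⁺: exact attachment PROFILES of the free vertices are forced -/

section Profiles

variable {m : ℕ}

/-- The profile probe of a vertex `a` against the ordered tuple `I` with row pattern `β`, column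
pattern `γ` and diagonal bit `δ`: `2r + 2` literal positions — positions `k < r` read
`x (a, I k) = β k`, positions `r ≤ k < 2r` read `x (I (k - r), a) = γ (k - r)`, the last two read
`x (a, a) = δ`; an ORDERED index `a` (`a + g < m`) instead reads `x (a, a)` everywhere with the
contradictory signs `true` at position `0` and `false` elsewhere (a dead probe), so that only free
vertices are counted. Positions: -/
def profPos (g : ℕ) {r : ℕ} (I : Fin r → Fin m) (a : Fin m) (k : Fin ((r + r) + 2)) : Fin m × Fin m :=
  if (a : ℕ) + g < m then (a, a)
  else if h : (k : ℕ) < r then (a, I ⟨k, h⟩)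
  else if h' : (k : ℕ) < r + r then (I ⟨k - r, by omega⟩, a) else (a, a)

/-- … and signs. -/
def profSign (g : ℕ) {r : ℕ} (β γ : Fin r → Bool) (δ : Bool) (a : Fin m) (k : Fin ((r + r) + 2)) :
    Bool :=
  if (a : ℕ) + g < m then decide ((k : ℕ) = 0)
  else if h : (k : ℕ) < r then β ⟨k, h⟩
  else if h' : (k : ℕ) < r + r then γ ⟨k - r, by omega⟩ else δ

/-- The profile family is `Bud(m, g)`-equivariant with `θ = ρ`. -/
theorem prof_equivariant (g : ℕ) {r : ℕ} (I : Fin r → Fin m) (hI : ∀ k, (I k : ℕ) + g < m)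
    (β γ : Fin r → Bool) (δ : Bool) :
    ∀ ρ ∈ pointStabiliserBudget m g, ∃ θ : Equiv.Perm (Fin m), ∀ (a : Fin m) (k : Fin ((r + r) + 2)),
      (ρ (profPos g I a k).1, ρ (profPos g I a k).2) = profPos g I (θ a) k ∧
        profSign g β γ δ a k = profSign g β γ δ (θ a) k := by
  intro ρ hρ
  refine ⟨ρ, fun a k => ?_⟩
  by_cases ha : (a : ℕ) + g < m
  · have hρa : ρ a = a := hρ a ha
    simp only [profPos, profSign, hρa, ha, ↓reduceIte, and_self]
  · have hρa : ¬ ((ρ a : ℕ) + g < m) := fun h => ha (by rwa [ρ.injective (hρ (ρ a) h)] at h)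
    simp only [profPos, profSign, ha, hρa, ↓reduceIte, and_true]
    by_cases h1 : (k : ℕ) < r
    · simp only [h1, ↓reduceDIte, hρ (I _) (hI _)]
    · by_cases h2 : (k : ℕ) < r + r
      · simp only [h1, h2, ↓reduceDIte, hρ (I _) (hI _)]
      · simp only [h1, h2, ↓reduceDIte]

/-- What the profile probe tests on a free vertex: row, column and diagonal patterns. -/
theorem prof_fires_iff_free (g : ℕ) {r : ℕ} (I : Fin r → Fin m) (β γ : Fin r → Bool) (δ : Bool)
    (x : Fin m × Fin m → Bool) (a : Fin m) (ha : ¬ ((a : ℕ) + g < m)) :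
    (∀ k, x (profPos g I a k) = profSign g β γ δ a k) ↔
      (∀ k, x (a, I k) = β k) ∧ (∀ k, x (I k, a) = γ k) ∧ x (a, a) = δ := by
  constructor
  · intro h
    refine ⟨fun k => ?_, fun k => ?_, ?_⟩
    · have := h ⟨k, by omega⟩
      simpa [profPos, profSign, ha, k.2] using this
    · have := h ⟨r + k, by omega⟩
      have h1 : ¬ (r + (k : ℕ) < r) := by omega
      have h2 : r + (k : ℕ) < r + r := by omega
      simpa [profPos, profSign, ha, h1, h2] using this
    · have := h ⟨r + r, by omega⟩
      simpa [profPos, profSign, ha] using this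
  · rintro ⟨hβ, hγ, hδ⟩ ⟨k, hk⟩
    simp only [profPos, profSign, ha, ↓reduceIte]
    by_cases h1 : k < r
    · simpa [h1] using hβ ⟨k, h1⟩
    · by_cases h2 : k < r + r
      · have := hγ ⟨k - r, by omega⟩
        simpa [h1, h2] using this
      · simpa [h1, h2] using hδ

/-- The profile probe never fires on an ordered vertex. -/
theorem prof_not_fires_ordered (g : ℕ) {r : ℕ} (I : Fin r → Fin m) (β γ : Fin r → Bool) (δ : Bool)
    (x : Fin m × Fin m → Bool) (a : Fin m) (ha : (a : ℕ) + g < m) :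
    ¬ ∀ k, x (profPos g I a k) = profSign g β γ δ a k := by
  intro h
  have h0 := h ⟨0, by omega⟩
  have h1 := h ⟨(r + r) + 1, by omega⟩
  simp only [profPos, profSign, ha, ↓reduceIte] at h0 h1
  rw [h0] at h1
  revert h1
  simp

/-- **T2⁺ (free-vertex PROFILE counts are forced).** If `(x, y)` fools the `Bud(m,g)`-symmetric
threshold circuits with `m² + m + 3` gates then, for every tuple `I` of ordered vertices and all
patterns `β, γ, δ`, `x` and `y` have the same number of FREE vertices `a` with `x (a, I k) = β k`,
`x (I k, a) = γ k` (all `k`) and `x (a, a) = δ`. -/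
theorem freeProfileCount_eq_of_fools {g s r : ℕ} (hs : m * m + (m + 3) ≤ s)
    {x y : Fin m × Fin m → Bool}
    (hf : ∀ C : Circuit (Fin m × Fin m), C.IsOver tcBasis → C.size ≤ s →
      C.IsSymmetricUnder (pointStabiliserBudget m g) → C.eval x = C.eval y)
    (I : Fin r → Fin m) (hI : ∀ k, (I k : ℕ) + g < m) (β γ : Fin r → Bool) (δ : Bool) :
    (Finset.univ.filter fun a : Fin m => ¬ ((a : ℕ) + g < m) ∧
        (∀ k, x (a, I k) = β k) ∧ (∀ k, x (I k, a) = γ k) ∧ x (a, a) = δ).card =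
      (Finset.univ.filter fun a : Fin m => ¬ ((a : ℕ) + g < m) ∧
        (∀ k, y (a, I k) = β k) ∧ (∀ k, y (I k, a) = γ k) ∧ y (a, a) = δ).card := by
  -- the two counts are the literal probe counts of the profile family
  have hcount : ∀ z : Fin m × Fin m → Bool,
      (Finset.univ.filter fun a : Fin m => ¬ ((a : ℕ) + g < m) ∧
        (∀ k, z (a, I k) = β k) ∧ (∀ k, z (I k, a) = γ k) ∧ z (a, a) = δ).card =
      GateFn.numOnes (fun a : Fin m => decide (∀ k, z (profPos g I a k) = profSign g β γ δ a k)) := by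
    intro z
    unfold GateFn.numOnes
    refine congrArg Finset.card (Finset.filter_congr fun a _ => ?_)
    rw [decide_eq_true_iff]
    by_cases ha : (a : ℕ) + g < m
    · simp only [ha, not_true_eq_false, false_and, false_iff]
      exact prof_not_fires_ordered g I β γ δ z a ha
    · rw [prof_fires_iff_free g I β γ δ z a ha]
      simp [ha]
  rw [hcount x, hcount y]
  -- and literal probe counts agree on a fooling pair, threshold by threshold
  have key : ∀ t, decide (t ≤ GateFn.numOnes (fun a : Fin m =>
      decide (∀ k, x (profPos g I a k) = profSign g β γ δ a k))) =
      decide (t ≤ GateFn.numOnes (fun a : Fin m =>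
      decide (∀ k, y (profPos g I a k) = profSign g β γ δ a k))) := by
    intro t
    obtain ⟨C, hCB, hCs, hCsym, hCcomp⟩ := hasSymCircuit_litCount (pointStabiliserBudget m g)
      (profPos g I) (profSign g β γ δ) (prof_equivariant g I hI β γ δ) t
    have hx := hCcomp x
    have hy := hCcomp y
    dsimp only at hx hy
    rw [← hx, ← hy]
    exact hf C hCB (hCs.trans hs) hCsym
  refine le_antisymm ?_ ?_
  · have h := key (GateFn.numOnes fun a : Fin m => decide (∀ k, x (profPos g I a k) = profSign g β γ δ a k))
    rw [decide_eq_true (le_refl _)] at h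
    exact of_decide_eq_true h.symm
  · have h := key (GateFn.numOnes fun a : Fin m => decide (∀ k, y (profPos g I a k) = profSign g β γ δ a k))
    rw [decide_eq_true (le_refl (GateFn.numOnes fun a : Fin m =>
      decide (∀ k, y (profPos g I a k) = profSign g β γ δ a k)))] at h
    exact of_decide_eq_true h

end Profiles


/-! ### T3⁺: exact profiles of PAIRS of free vertices are forced -/

section PairProfiles

variable {m : ℕ}

/-- The pair-profile probe of an ordered pair `q = (a, b)`: the profile probe of `a` (`2r + 2`
positions), then that of `b`, then the entries `(a, b)` and `(b, a)`; DEAD (all positions `(a, a)`,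
contradictory signs) unless both `a` and `b` are free. Positions: -/
def pairPos (g : ℕ) {r : ℕ} (I : Fin r → Fin m) (q : Fin m × Fin m)
    (k : Fin (((r + r) + 2) + ((r + r) + 2) + 2)) : Fin m × Fin m :=
  if (q.1 : ℕ) + g < m ∨ (q.2 : ℕ) + g < m then (q.1, q.1)
  else if h : (k : ℕ) < (r + r) + 2 then profPos g I q.1 ⟨k, h⟩
  else if h' : (k : ℕ) < ((r + r) + 2) + ((r + r) + 2) then profPos g I q.2 ⟨k - ((r + r) + 2), by omega⟩
  else if (k : ℕ) = ((r + r) + 2) + ((r + r) + 2) then (q.1, q.2) else (q.2, q.1)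

/-- … and signs. -/
def pairSign (g : ℕ) {r : ℕ} (β γ : Fin r → Bool) (δ : Bool) (β' γ' : Fin r → Bool) (δ' : Bool)
    (ε ε' : Bool) (q : Fin m × Fin m) (k : Fin (((r + r) + 2) + ((r + r) + 2) + 2)) : Bool :=
  if (q.1 : ℕ) + g < m ∨ (q.2 : ℕ) + g < m then decide ((k : ℕ) = 0)
  else if h : (k : ℕ) < (r + r) + 2 then profSign g β γ δ q.1 ⟨k, h⟩
  else if h' : (k : ℕ) < ((r + r) + 2) + ((r + r) + 2) then
    profSign g β' γ' δ' q.2 ⟨k - ((r + r) + 2), by omega⟩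
  else if (k : ℕ) = ((r + r) + 2) + ((r + r) + 2) then ε else ε'

/-- The pair-profile family is `Bud(m, g)`-equivariant (`ρ • pairPos q = pairPos (ρ • q)`, signs
invariant). -/
theorem pair_equivariant (g : ℕ) {r : ℕ} (I : Fin r → Fin m) (hI : ∀ k, (I k : ℕ) + g < m)
    (β γ : Fin r → Bool) (δ : Bool) (β' γ' : Fin r → Bool) (δ' : Bool) (ε ε' : Bool) :
    ∀ ρ ∈ pointStabiliserBudget m g, ∀ (q : Fin m × Fin m) (k : Fin (((r + r) + 2) + ((r + r) + 2) + 2)),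
      (ρ (pairPos g I q k).1, ρ (pairPos g I q k).2) = pairPos g I (ρ q.1, ρ q.2) k ∧
        pairSign g β γ δ β' γ' δ' ε ε' q k = pairSign g β γ δ β' γ' δ' ε ε' (ρ q.1, ρ q.2) k := by
  intro ρ hρ q k
  have hfree : ∀ a : Fin m, ((ρ a : ℕ) + g < m ↔ (a : ℕ) + g < m) := by
    intro a
    constructor
    · intro h
      rwa [ρ.injective (hρ (ρ a) h)] at h
    · intro h
      rwa [hρ a h]
  obtain ⟨θ₁, hθ₁⟩ := prof_equivariant g I hI β γ δ ρ hρ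
  obtain ⟨θ₂, hθ₂⟩ := prof_equivariant g I hI β' γ' δ' ρ hρ
  by_cases hd : (q.1 : ℕ) + g < m ∨ (q.2 : ℕ) + g < m
  · have hd' : ((ρ q.1 : Fin m) : ℕ) + g < m ∨ ((ρ q.2 : Fin m) : ℕ) + g < m := by
      rwa [hfree, hfree]
    simp only [pairPos, pairSign, hd, hd', ↓reduceIte, and_true]
  · have hd' : ¬ (((ρ q.1 : Fin m) : ℕ) + g < m ∨ ((ρ q.2 : Fin m) : ℕ) + g < m) := by
      rwa [hfree, hfree]
    -- on free vertices `prof_equivariant`'s `θ` is `ρ` itself: re-derive the two identities directly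
    have hP : ∀ (a : Fin m) (k' : Fin ((r + r) + 2)) (β₀ γ₀ : Fin r → Bool) (δ₀ : Bool),
        ¬ ((a : ℕ) + g < m) →
        (ρ (profPos g I a k').1, ρ (profPos g I a k').2) = profPos g I (ρ a) k' ∧
          profSign g β₀ γ₀ δ₀ a k' = profSign g β₀ γ₀ δ₀ (ρ a) k' := by
      intro a k' β₀ γ₀ δ₀ ha
      have hρa : ¬ ((ρ a : ℕ) + g < m) := by rwa [hfree]
      simp only [profPos, profSign, ha, hρa, ↓reduceIte, and_true]
      by_cases h1 : (k' : ℕ) < r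
      · simp only [h1, ↓reduceDIte, hρ (I _) (hI _)]
      · by_cases h2 : (k' : ℕ) < r + r
        · simp only [h1, h2, ↓reduceDIte, hρ (I _) (hI _)]
        · simp only [h1, h2, ↓reduceDIte]
    have ha : ¬ ((q.1 : ℕ) + g < m) := fun h => hd (Or.inl h)
    have hb : ¬ ((q.2 : ℕ) + g < m) := fun h => hd (Or.inr h)
    simp only [pairPos, pairSign, hd, hd', ↓reduceIte]
    by_cases h1 : (k : ℕ) < (r + r) + 2
    · simp only [h1, ↓reduceDIte]
      exact hP q.1 _ β γ δ ha
    · by_cases h2 : (k : ℕ) < ((r + r) + 2) + ((r + r) + 2)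
      · simp only [h1, h2, ↓reduceDIte]
        exact hP q.2 _ β' γ' δ' hb
      · by_cases h3 : (k : ℕ) = ((r + r) + 2) + ((r + r) + 2)
        · simp [h3]
        · simp [h1, h2, h3]

/-- What the pair-profile probe tests on a pair of free vertices. -/
theorem pair_fires_iff_free (g : ℕ) {r : ℕ} (I : Fin r → Fin m) (β γ : Fin r → Bool) (δ : Bool)
    (β' γ' : Fin r → Bool) (δ' : Bool) (ε ε' : Bool) (z : Fin m × Fin m → Bool) (q : Fin m × Fin m)
    (ha : ¬ ((q.1 : ℕ) + g < m)) (hb : ¬ ((q.2 : ℕ) + g < m)) :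
    (∀ k, z (pairPos g I q k) = pairSign g β γ δ β' γ' δ' ε ε' q k) ↔
      ((∀ k, z (q.1, I k) = β k) ∧ (∀ k, z (I k, q.1) = γ k) ∧ z (q.1, q.1) = δ) ∧
      ((∀ k, z (q.2, I k) = β' k) ∧ (∀ k, z (I k, q.2) = γ' k) ∧ z (q.2, q.2) = δ') ∧
      z (q.1, q.2) = ε ∧ z (q.2, q.1) = ε' := by
  have hd : ¬ ((q.1 : ℕ) + g < m ∨ (q.2 : ℕ) + g < m) := by tauto
  rw [← prof_fires_iff_free g I β γ δ z q.1 ha, ← prof_fires_iff_free g I β' γ' δ' z q.2 hb]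
  constructor
  · intro h
    refine ⟨fun k => ?_, fun k => ?_, ?_, ?_⟩
    · have := h ⟨k, by omega⟩
      simpa [pairPos, pairSign, hd, k.2] using this
    · have := h ⟨((r + r) + 2) + k, by omega⟩
      have h1 : ¬ (((r + r) + 2) + (k : ℕ) < (r + r) + 2) := by omega
      have h2 : ((r + r) + 2) + (k : ℕ) < ((r + r) + 2) + ((r + r) + 2) := by omega
      simpa [pairPos, pairSign, hd, h1, h2] using this
    · have := h ⟨((r + r) + 2) + ((r + r) + 2), by omega⟩
      have h1 : ¬ (((r + r) + 2) + ((r + r) + 2) < (r + r) + 2) := by omega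
      have h2 : ¬ (((r + r) + 2) + ((r + r) + 2) < ((r + r) + 2) + ((r + r) + 2)) := by omega
      simpa [pairPos, pairSign, hd, h1, h2] using this
    · have := h ⟨((r + r) + 2) + ((r + r) + 2) + 1, by omega⟩
      have h1 : ¬ (((r + r) + 2) + ((r + r) + 2) + 1 < (r + r) + 2) := by omega
      have h2 : ¬ (((r + r) + 2) + ((r + r) + 2) + 1 < ((r + r) + 2) + ((r + r) + 2)) := by omega
      have h3 : ¬ (((r + r) + 2) + ((r + r) + 2) + 1 = ((r + r) + 2) + ((r + r) + 2)) := by omega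
      simpa [pairPos, pairSign, hd, h1, h2, h3] using this
  · rintro ⟨h₁, h₂, h₃, h₄⟩ ⟨k, hk⟩
    simp only [pairPos, pairSign, hd, ↓reduceIte]
    by_cases h1 : k < (r + r) + 2
    · simpa [h1] using h₁ ⟨k, h1⟩
    · by_cases h2 : k < ((r + r) + 2) + ((r + r) + 2)
      · have := h₂ ⟨k - ((r + r) + 2), by omega⟩
        simpa [h1, h2] using this
      · by_cases h3 : k = ((r + r) + 2) + ((r + r) + 2)
        · simpa [h1, h2, h3] using h₃
        · have h4 : k = ((r + r) + 2) + ((r + r) + 2) + 1 := by omega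
          simpa [h1, h2, h3] using h₄

/-- The pair-profile probe never fires unless both vertices are free. -/
theorem pair_not_fires_dead (g : ℕ) {r : ℕ} (I : Fin r → Fin m) (β γ : Fin r → Bool) (δ : Bool)
    (β' γ' : Fin r → Bool) (δ' : Bool) (ε ε' : Bool) (z : Fin m × Fin m → Bool) (q : Fin m × Fin m)
    (hd : (q.1 : ℕ) + g < m ∨ (q.2 : ℕ) + g < m) :
    ¬ ∀ k, z (pairPos g I q k) = pairSign g β γ δ β' γ' δ' ε ε' q k := by
  intro h
  have h0 := h ⟨0, by omega⟩
  have h1 := h ⟨1, by omega⟩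
  simp only [pairPos, pairSign, hd, ↓reduceIte] at h0 h1
  rw [h0] at h1
  revert h1
  simp

/-- **T3⁺ (pair-profile counts of free vertices are forced).** If `(x, y)` fools the
`Bud(m,g)`-symmetric threshold circuits with `2m² + 3` gates then, for every tuple `I` of ordered
vertices and all patterns, `x` and `y` have the same number of ordered pairs `(a, b)` of FREE
vertices with the prescribed profile of `a` (`β, γ, δ`), of `b` (`β', γ', δ'`), and entries
`x (a, b) = ε`, `x (b, a) = ε'`. -/
theorem freePairProfileCount_eq_of_fools {g s r : ℕ} (hs : m * m + (m * m + 3) ≤ s)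
    {x y : Fin m × Fin m → Bool}
    (hf : ∀ C : Circuit (Fin m × Fin m), C.IsOver tcBasis → C.size ≤ s →
      C.IsSymmetricUnder (pointStabiliserBudget m g) → C.eval x = C.eval y)
    (I : Fin r → Fin m) (hI : ∀ k, (I k : ℕ) + g < m) (β γ : Fin r → Bool) (δ : Bool)
    (β' γ' : Fin r → Bool) (δ' : Bool) (ε ε' : Bool) :
    (Finset.univ.filter fun q : Fin m × Fin m => (¬ ((q.1 : ℕ) + g < m) ∧ ¬ ((q.2 : ℕ) + g < m)) ∧
        ((∀ k, x (q.1, I k) = β k) ∧ (∀ k, x (I k, q.1) = γ k) ∧ x (q.1, q.1) = δ) ∧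
        ((∀ k, x (q.2, I k) = β' k) ∧ (∀ k, x (I k, q.2) = γ' k) ∧ x (q.2, q.2) = δ') ∧
        x (q.1, q.2) = ε ∧ x (q.2, q.1) = ε').card =
      (Finset.univ.filter fun q : Fin m × Fin m => (¬ ((q.1 : ℕ) + g < m) ∧ ¬ ((q.2 : ℕ) + g < m)) ∧
        ((∀ k, y (q.1, I k) = β k) ∧ (∀ k, y (I k, q.1) = γ k) ∧ y (q.1, q.1) = δ) ∧
        ((∀ k, y (q.2, I k) = β' k) ∧ (∀ k, y (I k, q.2) = γ' k) ∧ y (q.2, q.2) = δ') ∧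
        y (q.1, q.2) = ε ∧ y (q.2, q.1) = ε').card := by
  -- the Fin (m*m)-indexed literal family and its counts
  set Q : Fin (m * m) → Fin (((r + r) + 2) + ((r + r) + 2) + 2) → Fin m × Fin m :=
    fun c k => pairPos g I (finProdFinEquiv.symm c) k with hQ
  set b : Fin (m * m) → Fin (((r + r) + 2) + ((r + r) + 2) + 2) → Bool :=
    fun c k => pairSign g β γ δ β' γ' δ' ε ε' (finProdFinEquiv.symm c) k with hb
  have hequiv : ∀ ρ ∈ pointStabiliserBudget m g, ∃ θ : Equiv.Perm (Fin (m * m)), ∀ c k,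
      (ρ (Q c k).1, ρ (Q c k).2) = Q (θ c) k ∧ b c k = b (θ c) k := by
    intro ρ hρ
    refine ⟨negPerm ρ, fun c k => ?_⟩
    have hc : finProdFinEquiv.symm (negPerm ρ c) =
        (ρ (finProdFinEquiv.symm c).1, ρ (finProdFinEquiv.symm c).2) := by
      obtain ⟨q, rfl⟩ : ∃ q : Fin m × Fin m, c = finProdFinEquiv q :=
        ⟨finProdFinEquiv.symm c, (Equiv.apply_symm_apply _ c).symm⟩
      rw [negPerm_apply, Equiv.symm_apply_apply, Equiv.symm_apply_apply]
    simp only [hQ, hb, hc]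
    exact pair_equivariant g I hI β γ δ β' γ' δ' ε ε' ρ hρ _ k
  have hcount : ∀ z : Fin m × Fin m → Bool,
      (Finset.univ.filter fun q : Fin m × Fin m => (¬ ((q.1 : ℕ) + g < m) ∧ ¬ ((q.2 : ℕ) + g < m)) ∧
        ((∀ k, z (q.1, I k) = β k) ∧ (∀ k, z (I k, q.1) = γ k) ∧ z (q.1, q.1) = δ) ∧
        ((∀ k, z (q.2, I k) = β' k) ∧ (∀ k, z (I k, q.2) = γ' k) ∧ z (q.2, q.2) = δ') ∧
        z (q.1, q.2) = ε ∧ z (q.2, q.1) = ε').card =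
      GateFn.numOnes (fun c : Fin (m * m) => decide (∀ k, z (Q c k) = b c k)) := by
    intro z
    unfold GateFn.numOnes
    refine Finset.card_equiv finProdFinEquiv (fun q => ?_)
    simp only [Finset.mem_filter, Finset.mem_univ, true_and, hQ, hb, Equiv.symm_apply_apply,
      decide_eq_true_iff]
    by_cases hd : (q.1 : ℕ) + g < m ∨ (q.2 : ℕ) + g < m
    · constructor
      · rintro ⟨⟨h1, h2⟩, -⟩
        exact (hd.elim h1 h2).elim
      · intro h
        exact (pair_not_fires_dead g I β γ δ β' γ' δ' ε ε' z q hd h).elim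
    · have ha : ¬ ((q.1 : ℕ) + g < m) := fun h => hd (Or.inl h)
      have hb' : ¬ ((q.2 : ℕ) + g < m) := fun h => hd (Or.inr h)
      rw [pair_fires_iff_free g I β γ δ β' γ' δ' ε ε' z q ha hb']
      tauto
  rw [hcount x, hcount y]
  have key : ∀ t, decide (t ≤ GateFn.numOnes (fun c : Fin (m * m) => decide (∀ k, x (Q c k) = b c k))) =
      decide (t ≤ GateFn.numOnes (fun c : Fin (m * m) => decide (∀ k, y (Q c k) = b c k))) := by
    intro t
    obtain ⟨C, hCB, hCs, hCsym, hCcomp⟩ :=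
      hasSymCircuit_litCount (pointStabiliserBudget m g) Q b hequiv t
    have hx := hCcomp x
    have hy := hCcomp y
    dsimp only at hx hy
    rw [← hx, ← hy]
    exact hf C hCB (hCs.trans hs) hCsym
  refine le_antisymm ?_ ?_
  · have h := key (GateFn.numOnes fun c : Fin (m * m) => decide (∀ k, x (Q c k) = b c k))
    rw [decide_eq_true (le_refl _)] at h
    exact of_decide_eq_true h.symm
  · have h := key (GateFn.numOnes fun c : Fin (m * m) => decide (∀ k, y (Q c k) = b c k))
    rw [decide_eq_true (le_refl (GateFn.numOnes fun c : Fin (m * m) =>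
      decide (∀ k, y (Q c k) = b c k)))] at h
    exact of_decide_eq_true h

end PairProfiles


section TwinFree

variable {m r : ℕ}

/-- **Combinatorial core of the twin-free separation.** -/
theorem budRelabel_of_counts {g : ℕ} (I : Fin r → Fin m) (hIO : ∀ i : Fin m, (i : ℕ) + g < m → ∃ k, I k = i)
    {x y : Fin m × Fin m → Bool}
    (h0 : ∀ q : Fin m × Fin m, (q.1 : ℕ) + g < m → (q.2 : ℕ) + g < m → x q = y q)
    (h1 : ∀ (β γ : Fin r → Bool) (δ : Bool),
      (Finset.univ.filter fun a : Fin m => ¬ ((a : ℕ) + g < m) ∧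
          (∀ k, x (a, I k) = β k) ∧ (∀ k, x (I k, a) = γ k) ∧ x (a, a) = δ).card =
        (Finset.univ.filter fun a : Fin m => ¬ ((a : ℕ) + g < m) ∧
          (∀ k, y (a, I k) = β k) ∧ (∀ k, y (I k, a) = γ k) ∧ y (a, a) = δ).card)
    (h2 : ∀ (β γ : Fin r → Bool) (δ : Bool) (β' γ' : Fin r → Bool) (δ' : Bool) (ε ε' : Bool),
      (Finset.univ.filter fun q : Fin m × Fin m => (¬ ((q.1 : ℕ) + g < m) ∧ ¬ ((q.2 : ℕ) + g < m)) ∧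
          ((∀ k, x (q.1, I k) = β k) ∧ (∀ k, x (I k, q.1) = γ k) ∧ x (q.1, q.1) = δ) ∧
          ((∀ k, x (q.2, I k) = β' k) ∧ (∀ k, x (I k, q.2) = γ' k) ∧ x (q.2, q.2) = δ') ∧
          x (q.1, q.2) = ε ∧ x (q.2, q.1) = ε').card =
        (Finset.univ.filter fun q : Fin m × Fin m => (¬ ((q.1 : ℕ) + g < m) ∧ ¬ ((q.2 : ℕ) + g < m)) ∧
          ((∀ k, y (q.1, I k) = β k) ∧ (∀ k, y (I k, q.1) = γ k) ∧ y (q.1, q.1) = δ) ∧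
          ((∀ k, y (q.2, I k) = β' k) ∧ (∀ k, y (I k, q.2) = γ' k) ∧ y (q.2, q.2) = δ') ∧
          y (q.1, q.2) = ε ∧ y (q.2, q.1) = ε').card)
    (htf : ∀ a b : Fin m, ¬ ((a : ℕ) + g < m) → ¬ ((b : ℕ) + g < m) →
      (∀ k, x (a, I k) = x (b, I k)) → (∀ k, x (I k, a) = x (I k, b)) → x (a, a) = x (b, b) → a = b) :
    ∃ ρ ∈ pointStabiliserBudget m g, ∀ q : Fin m × Fin m, y (ρ q.1, ρ q.2) = x q := by
  -- the y-matches of a free vertex `a`: free vertices of `y` with the x-profile of `a`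
  set Sy : Fin m → Finset (Fin m) := fun a => Finset.univ.filter fun b : Fin m =>
    ¬ ((b : ℕ) + g < m) ∧ (∀ k, y (b, I k) = x (a, I k)) ∧ (∀ k, y (I k, b) = x (I k, a)) ∧
      y (b, b) = x (a, a) with hSy
  have hSx : ∀ a : Fin m, ¬ ((a : ℕ) + g < m) →
      (Finset.univ.filter fun b : Fin m => ¬ ((b : ℕ) + g < m) ∧ (∀ k, x (b, I k) = x (a, I k)) ∧
        (∀ k, x (I k, b) = x (I k, a)) ∧ x (b, b) = x (a, a)) = {a} := by
    intro a ha
    refine Finset.eq_singleton_iff_unique_mem.2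
      ⟨Finset.mem_filter.2 ⟨Finset.mem_univ _, ha, fun _ => rfl, fun _ => rfl, rfl⟩, fun b hb => ?_⟩
    simp only [Finset.mem_filter, Finset.mem_univ, true_and] at hb
    exact htf b a hb.1 ha hb.2.1 hb.2.2.1 hb.2.2.2
  have hcard : ∀ a : Fin m, ¬ ((a : ℕ) + g < m) → (Sy a).card = 1 := by
    intro a ha
    have := h1 (fun k => x (a, I k)) (fun k => x (I k, a)) (x (a, a))
    rw [hSx a ha, Finset.card_singleton] at this
    exact this.symm
  -- the matching
  have hex : ∀ a : Fin m, ¬ ((a : ℕ) + g < m) → ∃ b, Sy a = {b} := fun a ha =>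
    Finset.card_eq_one.1 (hcard a ha)
  let π : Fin m → Fin m := fun a =>
    if ha : (a : ℕ) + g < m then a else Classical.choose (hex a ha)
  have hπord : ∀ a : Fin m, (a : ℕ) + g < m → π a = a := fun a ha => by simp [π, ha]
  have hπmem : ∀ a : Fin m, ¬ ((a : ℕ) + g < m) → π a ∈ Sy a := by
    intro a ha
    have h := Classical.choose_spec (hex a ha)
    simp only [π, ha, ↓reduceDIte]
    exact (Finset.eq_singleton_iff_unique_mem.1 h).1
  have hπuniq : ∀ a : Fin m, ¬ ((a : ℕ) + g < m) → ∀ b ∈ Sy a, b = π a := by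
    intro a ha b hb
    have h := Classical.choose_spec (hex a ha)
    simp only [π, ha, ↓reduceDIte]
    exact (Finset.eq_singleton_iff_unique_mem.1 h).2 b hb
  -- unpack membership in `Sy a`
  have hπspec : ∀ a : Fin m, ¬ ((a : ℕ) + g < m) →
      ¬ ((π a : ℕ) + g < m) ∧ (∀ k, y (π a, I k) = x (a, I k)) ∧ (∀ k, y (I k, π a) = x (I k, a)) ∧
        y (π a, π a) = x (a, a) := by
    intro a ha
    have h := hπmem a ha
    simp only [hSy, Finset.mem_filter, Finset.mem_univ, true_and] at h
    exact h
  -- `π` is injective, hence a permutation fixing the ordered vertices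
  have hinj : Function.Injective π := by
    intro a b hab
    by_cases ha : (a : ℕ) + g < m <;> by_cases hb : (b : ℕ) + g < m
    · rwa [hπord a ha, hπord b hb] at hab
    · exact absurd (by rw [← hπord a ha, hab]; exact (hπspec b hb).1) (not_not.2 ha)
    · exact absurd (by rw [← hπord b hb, ← hab]; exact (hπspec a ha).1) (not_not.2 hb)
    · obtain ⟨-, hr, hc, hd⟩ := hπspec a ha
      obtain ⟨-, hr', hc', hd'⟩ := hπspec b hb
      rw [hab] at hr hc hd
      exact htf a b ha hb (fun k => by rw [← hr k, hr' k]) (fun k => by rw [← hc k, hc' k])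
        (by rw [← hd, hd'])
  have hbij : Function.Bijective π := Finite.injective_iff_bijective.1 hinj
  refine ⟨Equiv.ofBijective π hbij, fun i hi => hπord i hi, ?_⟩
  -- the relabelled `y` is `x`
  rintro ⟨a, b⟩
  show y (π a, π b) = x (a, b)
  by_cases ha : (a : ℕ) + g < m <;> by_cases hb : (b : ℕ) + g < m
  · rw [hπord a ha, hπord b hb]
    exact (h0 (a, b) ha hb).symm
  · obtain ⟨k, rfl⟩ := hIO a ha
    rw [hπord _ ha]
    exact (hπspec b hb).2.2.1 k
  · obtain ⟨k, rfl⟩ := hIO b hb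
    rw [hπord _ hb]
    exact (hπspec a ha).2.1 k
  · by_cases hab : a = b
    · subst hab
      exact (hπspec a ha).2.2.2
    · -- the pair count with the profiles of `a`, `b` and the entries `x (a, b)`, `x (b, a)`
      have hcnt := h2 (fun k => x (a, I k)) (fun k => x (I k, a)) (x (a, a))
        (fun k => x (b, I k)) (fun k => x (I k, b)) (x (b, b)) (x (a, b)) (x (b, a))
      have hpos : 0 < (Finset.univ.filter fun q : Fin m × Fin m =>
          (¬ ((q.1 : ℕ) + g < m) ∧ ¬ ((q.2 : ℕ) + g < m)) ∧
          ((∀ k, y (q.1, I k) = x (a, I k)) ∧ (∀ k, y (I k, q.1) = x (I k, a)) ∧ y (q.1, q.1) = x (a, a)) ∧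
          ((∀ k, y (q.2, I k) = x (b, I k)) ∧ (∀ k, y (I k, q.2) = x (I k, b)) ∧ y (q.2, q.2) = x (b, b)) ∧
          y (q.1, q.2) = x (a, b) ∧ y (q.2, q.1) = x (b, a)).card := by
        rw [← hcnt]
        exact Finset.card_pos.2 ⟨(a, b), Finset.mem_filter.2 ⟨Finset.mem_univ _, ⟨ha, hb⟩,
          ⟨fun _ => rfl, fun _ => rfl, rfl⟩, ⟨fun _ => rfl, fun _ => rfl, rfl⟩, rfl, rfl⟩⟩
      obtain ⟨⟨a', b'⟩, hq⟩ := Finset.card_pos.1 hpos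
      simp only [Finset.mem_filter, Finset.mem_univ, true_and] at hq
      obtain ⟨⟨ha', hb'⟩, ⟨hra, hca, hda⟩, ⟨hrb, hcb, hdb⟩, hε, -⟩ := hq
      have ha'' : a' = π a := hπuniq a ha a' (by
        simp only [hSy, Finset.mem_filter, Finset.mem_univ, true_and]
        exact ⟨ha', hra, hca, hda⟩)
      have hb'' : b' = π b := hπuniq b hb b' (by
        simp only [hSy, Finset.mem_filter, Finset.mem_univ, true_and]
        exact ⟨hb', hrb, hcb, hdb⟩)
      rw [← ha'', ← hb'']
      exact hε

/-- `Bud(m, g)` is closed under inverses. -/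
theorem symm_mem_pointStabiliserBudget {g : ℕ} {ρ : Equiv.Perm (Fin m)}
    (hρ : ρ ∈ pointStabiliserBudget m g) : ρ.symm ∈ pointStabiliserBudget m g := by
  intro i hi
  rw [Equiv.symm_apply_eq]
  exact (hρ i hi).symm

/-- The canonical enumeration of the ordered vertices `0, …, m - g - 1`. -/
def ordEnum (m g : ℕ) (k : Fin (m - g)) : Fin m := ⟨k, by omega⟩

theorem ordEnum_lt (m g : ℕ) (k : Fin (m - g)) : ((ordEnum m g k : Fin m) : ℕ) + g < m := by
  simp only [ordEnum]
  omega

theorem ordEnum_surj (m g : ℕ) (i : Fin m) (hi : (i : ℕ) + g < m) : ∃ k, ordEnum m g k = i :=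
  ⟨⟨i, by omega⟩, Fin.ext rfl⟩

/-- **Twin-free pairs are separated.** If the free vertices of `x` have pairwise distinct profiles
(row on the ordered part, column on the ordered part, diagonal bit) and `(x, y)` fools every
`Bud(m, g)`-symmetric threshold circuit with at most `s ≥ 2m² + 3` gates, then `x ∘ (ρ × ρ) = y`
for some `ρ ∈ Bud(m, g)`. -/
theorem budRelabel_of_fools_of_twinFree {g s : ℕ} (hs : m * m + (m * m + 3) ≤ s)
    {x y : Fin m × Fin m → Bool}
    (hf : ∀ C : Circuit (Fin m × Fin m), C.IsOver tcBasis → C.size ≤ s →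
      C.IsSymmetricUnder (pointStabiliserBudget m g) → C.eval x = C.eval y)
    (htf : ∀ a b : Fin m, ¬ ((a : ℕ) + g < m) → ¬ ((b : ℕ) + g < m) →
      (∀ i : Fin m, (i : ℕ) + g < m → x (a, i) = x (b, i)) →
      (∀ i : Fin m, (i : ℕ) + g < m → x (i, a) = x (i, b)) → x (a, a) = x (b, b) → a = b) :
    ∃ ρ ∈ pointStabiliserBudget m g, ∀ q : Fin m × Fin m, x (ρ q.1, ρ q.2) = y q := by
  have hs' : m * m + (m + 3) ≤ s := le_trans (by nlinarith) hs
  obtain ⟨ρ, hρ, hρxy⟩ := budRelabel_of_counts (ordEnum m g) (ordEnum_surj m g)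
    (fun q h₁ h₂ => apply_eq_of_fools hf q fun ρ hρ => ⟨hρ q.1 h₁, hρ q.2 h₂⟩)
    (fun β γ δ => freeProfileCount_eq_of_fools hs' hf (ordEnum m g) (ordEnum_lt m g) β γ δ)
    (fun β γ δ β' γ' δ' ε ε' =>
      freePairProfileCount_eq_of_fools hs hf (ordEnum m g) (ordEnum_lt m g) β γ δ β' γ' δ' ε ε')
    (fun a b ha hb hr hc hd => htf a b ha hb
      (fun i hi => by obtain ⟨k, rfl⟩ := ordEnum_surj m g i hi; exact hr k)
      (fun i hi => by obtain ⟨k, rfl⟩ := ordEnum_surj m g i hi; exact hc k) hd)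
  refine ⟨ρ.symm, symm_mem_pointStabiliserBudget hρ, fun q => ?_⟩
  have := hρxy (ρ.symm q.1, ρ.symm q.2)
  simpa using this.symm

/-- **Hence a twin-free `x` is never the first component of an S4 witness pair**: the graphs are
`Bud`-isomorphic (the negation of the first clause of `stub_symmetricIndistinguishability` for the
pair). -/
theorem budIso_of_fools_of_twinFree {g s : ℕ} (hs : m * m + (m * m + 3) ≤ s)
    {x y : Fin m × Fin m → Bool}
    (hf : ∀ C : Circuit (Fin m × Fin m), C.IsOver tcBasis → C.size ≤ s →
      C.IsSymmetricUnder (pointStabiliserBudget m g) → C.eval x = C.eval y)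
    (htf : ∀ a b : Fin m, ¬ ((a : ℕ) + g < m) → ¬ ((b : ℕ) + g < m) →
      (∀ i : Fin m, (i : ℕ) + g < m → x (a, i) = x (b, i)) →
      (∀ i : Fin m, (i : ℕ) + g < m → x (i, a) = x (i, b)) → x (a, a) = x (b, b) → a = b) :
    ∃ ρ ∈ pointStabiliserBudget m g,
      (SimpleGraph.fromRel fun u v => x (ρ u, ρ v) = true) =
        (SimpleGraph.fromRel fun u v => y (u, v) = true) := by
  obtain ⟨ρ, hρ, h⟩ := budRelabel_of_fools_of_twinFree hs hf htf
  refine ⟨ρ, hρ, ?_⟩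
  have hfun : (fun u v => x (ρ u, ρ v) = true) = (fun u v => y (u, v) = true) := by
    funext u v
    rw [h (u, v)]
  rw [hfun]

end TwinFree


end Cycle2

/-! ## Cycle 2b — T1: a symmetric canoniser in the window refutes the crux (BN2's
`CanonisationKillsBarrier`, checked); the bridge edge unconditional -/

section Cycle2b
open Literature.Computability.Complexity.GateList Summit.PneNP.PneNP.Theorems.HeaderHardwiring

section Canonisation

/-- **A symmetric canoniser at budget `g` refutes the crux at budget `g`.** Hypothesis (the TAME
object, inline): a polynomial `q` and, for every `m ≥ 1`, a well-formed gate list `gs` over `tcBasis`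
with `|gs| ≤ q m`, designated wires `out q₀` (`q₀ : Fin m × Fin m`) and a map `CF` on matrices such
that (i) every `ρ ∈ Bud(m, g m)` extends to a gate permutation of `gs` satisfying the gate conditions
of `Circuit.IsInducedAut` and fixing every `out q₀`; (ii) the wire `out q₀` carries `CF x q₀`;
(iii) `CF x` lies in the `Bud(m, g m)`-orbit of `x`. Conclusion: there is NO `L ∈ P` with
`Bud(·, g ·)`-invariant graph slices that are, for every polynomial size bound, infinitely often not
computable by `Bud`-symmetric threshold circuits — compose the canoniser with the `P ⊆ P/poly`
circuit for the slice (`slice_circuit_of_mem_P`) by `isSymmetricUnder_top`. -/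
theorem windowBarrierAt_false_of_symCanonisation (g : ℕ → ℕ) (q : Polynomial ℕ)
    (hcan : ∀ m : ℕ, 1 ≤ m →
      ∃ (gs : List (Gate (Fin m × Fin m))) (out : Fin m × Fin m → (Fin m × Fin m) ⊕ ℕ)
        (CF : (Fin m × Fin m → Bool) → (Fin m × Fin m → Bool)),
        WF gs ∧ (∀ gt ∈ gs, gt.fn ∈ tcBasis) ∧ gs.length ≤ q.eval m ∧ WiresOK gs.length out ∧
        (∀ ρ ∈ pointStabiliserBudget m (g m), ∃ τ : Equiv.Perm (Fin gs.length),
          (∀ q₀, Circuit.relabelWire (fun p : Fin m × Fin m => (ρ p.1, ρ p.2)) τ (out q₀) = out q₀) ∧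
          ∀ j : Fin gs.length, (gs[τ j]).fn = (gs[j]).fn ∧
            (List.ofFn (gs[τ j]).args).Perm ((List.ofFn (gs[j]).args).map
              (Circuit.relabelWire (fun p : Fin m × Fin m => (ρ p.1, ρ p.2)) τ))) ∧
        (∀ x q₀, wireOf x (vals gs x) (out q₀) = CF x q₀) ∧
        (∀ x, ∃ ρ ∈ pointStabiliserBudget m (g m), ∀ q₀, CF x q₀ = x (ρ q₀.1, ρ q₀.2))) :
    ¬ ∃ L ∈ Classes.P,
        (∀ (m : ℕ), ∀ ρ ∈ pointStabiliserBudget m (g m), ∀ x : Fin m × Fin m → Bool,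
            (encodingGraph.encode ⟨m, SimpleGraph.fromRel fun u v =>
                (fun q : Fin m × Fin m => x (ρ q.1, ρ q.2)) (u, v) = true⟩ ∈ L ↔
              encodingGraph.encode ⟨m, (SimpleGraph.fromRel fun u v => x (u, v) = true)⟩ ∈ L)) ∧
          ∀ p : Polynomial ℕ, ∃ᶠ m in atTop,
            ¬ HasSymCircuit tcBasis (pointStabiliserBudget m (g m)) (p.eval m)
              (fun x : Fin m × Fin m → Bool =>
                decide (encodingGraph.encode ⟨m, (SimpleGraph.fromRel fun u v => x (u, v) = true)⟩ ∈ L)) := by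
  rintro ⟨L, hL, hinv, hhard⟩
  obtain ⟨r, hr⟩ := _root_.Summit.PneNP.WindowBarrier.Negative.slice_circuit_of_mem_P hL
  obtain ⟨m, hno, hm⟩ := ((hhard (q + r)).and_eventually (eventually_ge_atTop 1)).exists
  obtain ⟨D, hDB, hDs, hDcomp⟩ := hr m hm
  obtain ⟨gs, out, CF, hwf, hB, hlen, hout, hsym, hsem, hcf⟩ := hcan m hm
  obtain ⟨E, hEg, hEo⟩ := exists_top gs hwf D out hout
  refine hno ⟨E, isOver_top gs hB D hDB out gs.length E hEg, ?_, ?_, ?_⟩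
  · rw [size_top gs D out gs.length E hEg, Polynomial.eval_add]
    have : D.size ≤ r.eval m := hDs
    omega
  · exact isSymmetricUnder_top _ gs hwf D out hout E hEg hEo hsym
  · intro x
    rw [eval_top gs D out hout E hEg hEo x]
    have hx : (fun i => wireOf x (vals gs x) (out i)) = CF x := funext (hsem x)
    obtain ⟨ρ, hρ, hρx⟩ := hcf x
    have hx' : CF x = fun q₀ => x (ρ q₀.1, ρ q₀.2) := funext hρx
    rw [hx, hx', hDcomp]
    exact (decide_eq_decide).2 (hinv m ρ hρ x)

/-- **T1 at the crux's budget `⌊log₂ m⌋`**: a symmetric canoniser in the window refutes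
`WindowBarrier` (the route decl, whose inline `Sym`/`HasSym`/`Bud`/`Gr` unfold definitionally). -/
theorem windowBarrier_false_of_symCanonisation (q : Polynomial ℕ)
    (hcan : ∀ m : ℕ, 1 ≤ m →
      ∃ (gs : List (Gate (Fin m × Fin m))) (out : Fin m × Fin m → (Fin m × Fin m) ⊕ ℕ)
        (CF : (Fin m × Fin m → Bool) → (Fin m × Fin m → Bool)),
        WF gs ∧ (∀ gt ∈ gs, gt.fn ∈ tcBasis) ∧ gs.length ≤ q.eval m ∧ WiresOK gs.length out ∧
        (∀ ρ ∈ pointStabiliserBudget m (Nat.log 2 m), ∃ τ : Equiv.Perm (Fin gs.length),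
          (∀ q₀, Circuit.relabelWire (fun p : Fin m × Fin m => (ρ p.1, ρ p.2)) τ (out q₀) = out q₀) ∧
          ∀ j : Fin gs.length, (gs[τ j]).fn = (gs[j]).fn ∧
            (List.ofFn (gs[τ j]).args).Perm ((List.ofFn (gs[j]).args).map
              (Circuit.relabelWire (fun p : Fin m × Fin m => (ρ p.1, ρ p.2)) τ))) ∧
        (∀ x q₀, wireOf x (vals gs x) (out q₀) = CF x q₀) ∧
        (∀ x, ∃ ρ ∈ pointStabiliserBudget m (Nat.log 2 m), ∀ q₀, CF x q₀ = x (ρ q₀.1, ρ q₀.2))) :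
    ¬ WindowBarrier :=
  windowBarrierAt_false_of_symCanonisation (Nat.log 2) q hcan

/-- **… and would turn the lower-bound crux `WindowHam` directly into `HAMCIRCUIT ∉ P`** (with
`ham_not_mem_P_of_not_windowBarrier`): the generic bridge that the route does not claim is exactly a
symmetric canoniser in the window. -/
theorem ham_not_mem_P_of_symCanonisation (q : Polynomial ℕ)
    (hcan : ∀ m : ℕ, 1 ≤ m →
      ∃ (gs : List (Gate (Fin m × Fin m))) (out : Fin m × Fin m → (Fin m × Fin m) ⊕ ℕ)
        (CF : (Fin m × Fin m → Bool) → (Fin m × Fin m → Bool)),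
        WF gs ∧ (∀ gt ∈ gs, gt.fn ∈ tcBasis) ∧ gs.length ≤ q.eval m ∧ WiresOK gs.length out ∧
        (∀ ρ ∈ pointStabiliserBudget m (Nat.log 2 m), ∃ τ : Equiv.Perm (Fin gs.length),
          (∀ q₀, Circuit.relabelWire (fun p : Fin m × Fin m => (ρ p.1, ρ p.2)) τ (out q₀) = out q₀) ∧
          ∀ j : Fin gs.length, (gs[τ j]).fn = (gs[j]).fn ∧
            (List.ofFn (gs[τ j]).args).Perm ((List.ofFn (gs[j]).args).map
              (Circuit.relabelWire (fun p : Fin m × Fin m => (ρ p.1, ρ p.2)) τ))) ∧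
        (∀ x q₀, wireOf x (vals gs x) (out q₀) = CF x q₀) ∧
        (∀ x, ∃ ρ ∈ pointStabiliserBudget m (Nat.log 2 m), ∀ q₀, CF x q₀ = x (ρ q₀.1, ρ q₀.2)))
    (hW : WindowHam) : HAMCIRCUIT ∉ Classes.P :=
  _root_.Summit.PneNP.WindowBarrier.Negative.ham_not_mem_P_of_not_windowBarrier
    (windowBarrier_false_of_symCanonisation q hcan) hW

end Canonisation


/-! ### The TAME hypothesis, named (workfile only), and the crux -/

section Tame

/-- **TAME at budget `g` with size bound `q`** (the disproof's standing hypothesis, cf. BN2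
`WindowCanonisation`): for every `m ≥ 1` a `Bud(m, g m)`-symmetric multi-output prefix over `tcBasis`
of size `≤ q m` whose `m²` designated wires carry a map `CF` with `CF x` in the `Bud`-orbit of `x`
(a symmetric canoniser of `m × m` matrices under the budget's conjugation action). -/
def SymCanonisation (g : ℕ → ℕ) (q : Polynomial ℕ) : Prop :=
  ∀ m : ℕ, 1 ≤ m →
    ∃ (gs : List (Gate (Fin m × Fin m))) (out : Fin m × Fin m → (Fin m × Fin m) ⊕ ℕ)
      (CF : (Fin m × Fin m → Bool) → (Fin m × Fin m → Bool)),
      WF gs ∧ (∀ gt ∈ gs, gt.fn ∈ tcBasis) ∧ gs.length ≤ q.eval m ∧ WiresOK gs.length out ∧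
      (∀ ρ ∈ pointStabiliserBudget m (g m), ∃ τ : Equiv.Perm (Fin gs.length),
        (∀ q₀, Circuit.relabelWire (fun p : Fin m × Fin m => (ρ p.1, ρ p.2)) τ (out q₀) = out q₀) ∧
        ∀ j : Fin gs.length, (gs[τ j]).fn = (gs[j]).fn ∧
          (List.ofFn (gs[τ j]).args).Perm ((List.ofFn (gs[j]).args).map
            (Circuit.relabelWire (fun p : Fin m × Fin m => (ρ p.1, ρ p.2)) τ))) ∧
      (∀ x q₀, wireOf x (vals gs x) (out q₀) = CF x q₀) ∧
      (∀ x, ∃ ρ ∈ pointStabiliserBudget m (g m), ∀ q₀, CF x q₀ = x (ρ q₀.1, ρ q₀.2))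

/-- **TAME at budget `g` kills the crux at budget `g`** (named form of
`windowBarrierAt_false_of_symCanonisation`). -/
theorem not_windowBarrierAt_of_symCanonisation {g : ℕ → ℕ} {q : Polynomial ℕ}
    (h : SymCanonisation g q) : ¬ WindowBarrierAt g :=
  windowBarrierAt_false_of_symCanonisation g q h

/-- **TAME in the window kills `WindowBarrier`.** -/
theorem not_windowBarrier_of_symCanonisation {q : Polynomial ℕ} (h : SymCanonisation (Nat.log 2) q) :
    ¬ WindowBarrier :=
  windowBarrier_false_of_symCanonisation q h

/-- **… and makes the lower-bound crux `WindowHam` a proof of `P ≠ NP`** (via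
`pneNP_of_not_windowBarrier_of_windowHam`). -/
theorem pneNP_of_symCanonisation_of_windowHam {q : Polynomial ℕ} (h : SymCanonisation (Nat.log 2) q)
    (hW : WindowHam) : PneNP :=
  pneNP_of_not_windowBarrier_of_windowHam (not_windowBarrier_of_symCanonisation h) hW

end Tame



end Cycle2b

end Summit.PneNP.PneNP.Cruxes.WindowBarrier.Disproof
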